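import Literature.NumberTheory.FaltingsSerre.ExtensionGroupsS5b

/-!
# The Faltings–Serre method after Brumer–Pacetti–Poor–Tornaría–Voight–Yuen, XII:
# the extension groups of Theorem 5.3.1 — MEANING of the kernel certificate

Companion of `ExtensionGroupsS5b.lean` (the KERNEL CERTIFICATE of [BPPTVY, Thm 5.3.1, p. 1176]:
A. Brumer, A. Pacetti, C. Poor, G. Tornaría, J. Voight, D. S. Yuen, *On the paramodularity of typical abelian
surfaces*, Algebra & Number Theory **13**:5 (2019) 1145–1195 [cite: BrumerEtAl2019]).  That file proves `39`
closed Boolean identities by `decide +kernel`; THIS file is the ordinary mathematics which turns them into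
theorems quantified over ALL codes / pairs / subspaces of the bit model (cell pub-paramod, DIVERGENCE.md D-18).
Nothing here is computational beyond two small auxiliary kernel checks (`check_basis`: associativity and unit
laws of the bit-matrix product on the `16` unit vectors; `check_tables`: sizes and bounds of the element tables).

## What is proved (all statements are about the bit model of `ExtensionGroupsS5b.lean`)

* `IsLin` / `InSpan` calculus (Part II.1–II.4): XOR-linearity of `rowMul`, `mmul` (both arguments), `conj`,
  `red B`, `comb L`, the cocycle-value map `cw` and the defects `defect`; soundness AND completeness of
  sequential reduction against a self-reducing basis (`red_eq_zero_iff : red B x = 0 ↔ x ∈ span(vecs B)`),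
  and the complement/syndrome principle `inSpan_of_syndrome` (a linear functional vanishing on `B` and
  non-vanishing on every non-zero combination of a complement `C` cuts `span B` out of `span (B ++ C)`).
* M1 `inS_iff_red_sB` : for every code `a < 2¹⁶`, `a ∈ 𝔰` (the Boolean test `inS`: `(Ja)ᵀ = Ja`) iff
  `red sB a = 0` iff `a ∈ span sB` — `𝔰𝔭₄(𝔽₂)` IS the span of the ten tabulated vectors.
* M4 `isAdm_iff_red_admB` : for every `m < 2¹⁶`, `m` is admissible (`m - g·m ∈ 𝔰` for both generators)
  iff `m ∈ span admB` (`= 𝔰 + 𝔽₂·diag(1,1,0,0)`, `2¹¹` elements).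
* M3 `isCocyclePair_iff` : for every `j < 8` and EVERY packed pair `z` (no size bound needed),
  `IsCocyclePair j z` (both components in `𝔰` and all `240` defects in `span(VB j)`) iff `red (SOLB j) z = 0`
  iff `z ∈ span(SOLB j)`; here `defect_tree`/`EL_facts` identify the element table with the values of the
  `120` normal-form words and the defects with the cocycle identity along left multiplication by generators.
* M5 `extension_classes_M`, `extension_classes_S`, `total_classes` : for every `j < 8`, every cocycle pair is
  equivalent — modulo `span(gensQ)`, the pairs of `VB j` plus the coboundaries `cob m = (m - g₀·m, m - g₁·m)` of
  all admissible `m` (resp. all `m ∈ 𝔰`) — to EXACTLY ONE tabulated representative `REPSM j` (resp. `REPSS j`);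
  the representatives are cocycle pairs, pairwise inequivalent, and their numbers sum to `10` (resp. `18`) over
  the eight submodules, with `dim V` multiset `{0,0,1,4,4,5,5,6,9,10}` (`kMultiset_M` of Part I).
* M2 `submodules_classified` : EVERY subset `S ⊆ 𝔰` containing `0`, closed under `+` and under conjugation by
  the two generators `ι(1 2 3 4 5)`, `ι(1 2)` of `G = ι(S₅(b))` is `span(VB j)` for one of the eight tabulated
  `j` (and these are pairwise distinct, `VB_distinct`).  Ingredients: `mmul_assoc` (so conjugation is a
  `G`-action and generator-stability is `G`-stability, `conj_word_mem`, `conj_el_mem`), soundness of echelon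
  insertion (`ins_sub`, `ins_mem`, `foldIns_*`), the orbit certificate (`cyclic_submodule`: the span of the
  orbit of any `x ∈ 𝔰` is a tabulated `VB c`, via the `34` orbit representatives and conjugation-invariance
  of spans of orbits) and the sum table (`sum_facts`), assembled by induction over the finite set of tabulated
  submodules contained in `S`.

## The dictionary to subgroups `E ≤ 𝔰 ⋊ G` with `π(E) = G` ([BPPTVY, §2.3, Lemma 2.3.4; §3.1 (3.1.6)])

With `V := E ∩ 𝔰` (a `G`-submodule, hence `= span(VB j)` by M2) and `c_E(g) :=` the `𝔰`-coordinate of any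
element of `E` above `g` (well defined modulo `V`), `c_E` is a 1-cocycle `G → 𝔰/V`; it is determined by
`(c_E(g₀), c_E(g₁))`, whose packed code is a cocycle pair (M3, the `120` words give every `g ∈ G` exactly once,
`S6Subgroups.stabWords_complete`), and conversely every cocycle pair `z` defines the subgroup
`E_z := {(cw z w + v, e_w) : w a normal-form word, v ∈ V}`.  Conjugating `E` by `(m, h) ∈ M ⋊ G` replaces the
pair by `pair(c ∘ Ad h) + cob(c(h)) + cob(m)` with `m` necessarily admissible (`M = M₄(𝔽₂)`) resp. in `𝔰`
(`M = 𝔰`); since `span(gensQ)` contains all `cob` of such `m` and is `Ad(G)`-stable, `M ⋊ G`-conjugacy of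
subgroups with the same `V` is exactly `CobEquiv` of their pairs, and subgroups with different `V` are not
conjugate.  Hence M5 says: `10` classes under `M₄(𝔽₂) ⋊ G`, `18` under `𝔰𝔭₄(𝔽₂) ⋊ G` — the printed numbers.
This last paragraph (the passage from the bit model to `Subgroup (𝔰 ⋊ G)`) is NOT formalised here; it is the
standard non-abelian-cohomology bookkeeping of [BPPTVY, §2.3] and is recorded as prose (D-18).

## References
* [BPPTVY] ANT 13:5 (2019): Thm 5.3.1 and proof p. 1176; §2.3 (Lemma 2.3.4) pp. 1155–1157; §3.1 (3.1.6)
  p. 1162; §5.1 p. 1173. [cite: BrumerEtAl2019]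
-/

set_option linter.style.longFile 0

namespace Literature.NumberTheory.FaltingsSerre.GSp4F2.Ext

open Matrix Equiv Equiv.Perm

/-! ## Part II — MEANING of the certificates: `𝔽₂`-linear algebra on bit-vectors

Everything below is ordinary (non-computational) mathematics: XOR-linearity of the bit-model operations,
the span / reduction calculus, and the theorems that turn the kernel certificates of Part I into statements
quantified over ALL codes, pairs and subspaces. -/

section LinAlg

/-! ### II.1 XOR identities and linear maps -/

/-- `(a ⊕ b) ⊕ (c ⊕ d) = (a ⊕ c) ⊕ (b ⊕ d)` for `Nat.xor`. [folklore] -/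
theorem xor4 (a b c d : ℕ) : (a ^^^ b) ^^^ (c ^^^ d) = (a ^^^ c) ^^^ (b ^^^ d) := by
  apply Nat.eq_of_testBit_eq; intro i
  simp only [Nat.testBit_xor]
  cases a.testBit i <;> cases b.testBit i <;> cases c.testBit i <;> cases d.testBit i <;> rfl

/-- `a ⊕ b ⊕ c = a ⊕ c ⊕ b` for `Nat.xor`. [folklore] -/
theorem xor_right_comm' (a b c : ℕ) : a ^^^ b ^^^ c = a ^^^ c ^^^ b := by
  apply Nat.eq_of_testBit_eq; intro i
  simp only [Nat.testBit_xor]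
  cases a.testBit i <;> cases b.testBit i <;> cases c.testBit i <;> rfl

/-- `(a ⊕ b) ⊕ (b ⊕ c) = a ⊕ c` for `Nat.xor`. [folklore] -/
theorem xor_cancel_mid (x m r : ℕ) : x ^^^ r = (x ^^^ m) ^^^ (m ^^^ r) := by
  apply Nat.eq_of_testBit_eq; intro i
  simp only [Nat.testBit_xor]
  cases x.testBit i <;> cases m.testBit i <;> cases r.testBit i <;> rfl

/-- `a ⊕ b = 0 ↔ a = b` for `Nat.xor`. [folklore] -/
theorem xor_eq_zero_iff_eq (a b : ℕ) : a ^^^ b = 0 ↔ a = b := by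
  constructor
  · intro h
    apply Nat.eq_of_testBit_eq; intro i
    have := congrArg (fun n => n.testBit i) h
    simp only [Nat.testBit_xor, Nat.zero_testBit] at this
    cases ha : a.testBit i <;> cases hb : b.testBit i <;> simp [ha, hb] at this ⊢
  · rintro rfl; exact Nat.xor_self _

/-- `Nat.xor` preserves the bound `< 2ⁿ`. [folklore] -/
theorem xor_lt_two_pow' {a b n : ℕ} (ha : a < 2 ^ n) (hb : b < 2 ^ n) : a ^^^ b < 2 ^ n :=
  Nat.xor_lt_two_pow ha hb

/-- `𝔽₂`-linearity (additivity for XOR) of a map on bit-vectors. [folklore] -/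
def IsLin (f : ℕ → ℕ) : Prop := ∀ x y, f (x ^^^ y) = f x ^^^ f y

/-- A XOR-linear map sends `0` to `0`. [folklore] -/
theorem IsLin.map_zero {f : ℕ → ℕ} (hf : IsLin f) : f 0 = 0 := by
  have h := hf 0 0
  rw [Nat.zero_xor] at h
  rw [h]; exact Nat.xor_self _

/-- Composition of XOR-linear maps is XOR-linear. [folklore] -/
theorem IsLin.comp {f g : ℕ → ℕ} (hf : IsLin f) (hg : IsLin g) : IsLin (fun x => f (g x)) :=
  fun x y => by simp only [hg x y, hf (g x) (g y)]

/-- Pointwise XOR of XOR-linear maps is XOR-linear. [folklore] -/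
theorem IsLin.xor {f g : ℕ → ℕ} (hf : IsLin f) (hg : IsLin g) : IsLin (fun x => f x ^^^ g x) :=
  fun x y => by simp only [hf x y, hg x y, xor4]

/-- The identity is XOR-linear. [folklore] -/
theorem IsLin.id : IsLin (fun x => x) := fun _ _ => rfl

/-- Bit selection `(· >>> i) % 2` is additive for XOR. [folklore] -/
theorem sel_xor (k v x y : ℕ) : (bif (x ^^^ y).testBit k then v else 0) =
    (bif x.testBit k then v else 0) ^^^ (bif y.testBit k then v else 0) := by
  simp only [Nat.testBit_xor]
  cases x.testBit k <;> cases y.testBit k <;> simp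

/-- Bit selection is XOR-linear. [folklore] -/
theorem IsLin.sel (k v : ℕ) : IsLin (fun x => bif x.testBit k then v else 0) :=
  fun x y => sel_xor k v x y

/-- `bif`-masking by a fixed bit of the argument of a XOR-linear map is XOR-linear. [folklore] -/
theorem IsLin.cond (c : Bool) {f : ℕ → ℕ} (hf : IsLin f) : IsLin (fun x => bif c then f x else 0) := by
  intro x y; cases c <;> simp [hf x y]

/-- selecting by a bit of a linear image. [folklore] -/
theorem IsLin.bitSel {h : ℕ → ℕ} (hh : IsLin h) (k v : ℕ) :
    IsLin (fun x => bif (h x).testBit k then v else 0) :=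
  fun x y => by simp only [hh x y]; exact sel_xor k v (h x) (h y)

/-- `<<<` distributes over XOR. [folklore] -/
theorem shiftLeft_xor' (x y n : ℕ) : (x ^^^ y) <<< n = x <<< n ^^^ y <<< n := by
  apply Nat.eq_of_testBit_eq; intro i
  simp only [Nat.testBit_shiftLeft, Nat.testBit_xor]
  by_cases h : i ≥ n <;> simp [h]

/-- `>>>` distributes over XOR. [folklore] -/
theorem shiftRight_xor' (x y n : ℕ) : (x ^^^ y) >>> n = x >>> n ^^^ y >>> n := by
  apply Nat.eq_of_testBit_eq; intro i
  simp only [Nat.testBit_shiftRight, Nat.testBit_xor]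

/-- `% 2ⁿ` distributes over XOR. [folklore] -/
theorem mod_two_pow_xor' (x y n : ℕ) : (x ^^^ y) % 2 ^ n = x % 2 ^ n ^^^ y % 2 ^ n := by
  apply Nat.eq_of_testBit_eq; intro i
  simp only [Nat.testBit_mod_two_pow, Nat.testBit_xor]
  by_cases h : i < n <;> simp [h]

/-- Post-composition with `<<< k` preserves XOR-linearity. [folklore] -/
theorem IsLin.shiftLeft (n : ℕ) : IsLin (fun x => x <<< n) := fun x y => shiftLeft_xor' x y n
/-- Post-composition with `>>> k` preserves XOR-linearity. [folklore] -/
theorem IsLin.shiftRight (n : ℕ) : IsLin (fun x => x >>> n) := fun x y => shiftRight_xor' x y n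
/-- Post-composition with `% 2ⁿ` preserves XOR-linearity. [folklore] -/
theorem IsLin.modPow (n : ℕ) : IsLin (fun x => x % 2 ^ n) := fun x y => mod_two_pow_xor' x y n

/-! ### II.2 Linearity of the bit-model matrix operations -/

/-- Extracting row `i` of a code is XOR-linear. [folklore] -/
theorem row_lin (i : ℕ) : IsLin (fun a => row a i) := by
  intro x y
  show ((x ^^^ y) >>> (4 * i)) % 2 ^ 4 = (x >>> (4 * i)) % 2 ^ 4 ^^^ (y >>> (4 * i)) % 2 ^ 4
  rw [shiftRight_xor', mod_two_pow_xor']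

/-- `rowMul` (row-vector times matrix code) is XOR-linear in the row. [folklore] -/
theorem rowMul_lin_left (b : ℕ) : IsLin (fun r => rowMul r b) := fun x y => by
  simp only [rowMul]
  exact (((IsLin.sel 0 _).xor (IsLin.sel 1 _)).xor (IsLin.sel 2 _) |>.xor (IsLin.sel 3 _)) x y

/-- `rowMul` is XOR-linear in the matrix code. [folklore] -/
theorem rowMul_lin_right (r : ℕ) : IsLin (fun b => rowMul r b) := fun x y => by
  simp only [rowMul]
  exact (((IsLin.cond _ (row_lin 0)).xor (IsLin.cond _ (row_lin 1))).xor (IsLin.cond _ (row_lin 2))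
    |>.xor (IsLin.cond _ (row_lin 3))) x y

/-- The bit-matrix product `mmul` is XOR-linear in the left factor. [folklore] -/
theorem mmul_lin_left (b : ℕ) : IsLin (fun a => mmul a b) := fun x y => by
  simp only [mmul]
  exact ((((rowMul_lin_left b).comp (row_lin 0)).xor
    ((IsLin.shiftLeft 4).comp ((rowMul_lin_left b).comp (row_lin 1)))).xor
    ((IsLin.shiftLeft 8).comp ((rowMul_lin_left b).comp (row_lin 2))) |>.xor
    ((IsLin.shiftLeft 12).comp ((rowMul_lin_left b).comp (row_lin 3)))) x y

/-- The bit-matrix product `mmul` is XOR-linear in the right factor. [folklore] -/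
theorem mmul_lin_right (a : ℕ) : IsLin (fun b => mmul a b) := fun x y => by
  simp only [mmul]
  exact (((rowMul_lin_right _).xor ((IsLin.shiftLeft 4).comp (rowMul_lin_right _))).xor
    ((IsLin.shiftLeft 8).comp (rowMul_lin_right _)) |>.xor
    ((IsLin.shiftLeft 12).comp (rowMul_lin_right _))) x y

/-- Conjugation `x ↦ g x gi` of codes is XOR-linear. [folklore] -/
theorem conj_lin (g gi : ℕ) : IsLin (conj g gi) := fun x y => by
  simp only [conj]
  exact ((mmul_lin_left gi).comp (mmul_lin_right g)) x y

/-- The generator-value extractor `xc a` of a packed pair is XOR-linear in the pair. [folklore] -/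
theorem xc_lin (a : ℕ) : IsLin (fun z => xc z a) := by
  intro x y
  by_cases h : a = 0
  · subst h
    show (x ^^^ y) % 2 ^ 16 = x % 2 ^ 16 ^^^ y % 2 ^ 16
    exact mod_two_pow_xor' x y 16
  · have hb : (a == 0) = false := by simp [h]
    simp only [xc, hb, cond_false]
    exact shiftRight_xor' x y 16

/-- The word-cocycle value `cw · w` is XOR-linear in the packed pair. [folklore] -/
theorem cw_lin (w : List (Fin 2)) : IsLin (fun z => cw z w) := by
  induction w with
  | nil => intro x y; simp [cw]
  | cons a w ih =>
    intro x y
    simp only [cw]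
    rw [show xc (x ^^^ y) a.val = xc x a.val ^^^ xc y a.val from xc_lin a.val x y,
      show cw (x ^^^ y) w = cw x w ^^^ cw y w from ih x y, conj_lin, xor4]

/-- The cocycle defect `defect · a k` is XOR-linear in the packed pair. [folklore] -/
theorem defect_lin (a k : ℕ) : IsLin (fun z => defect z a k) := fun x y => by
  simp only [defect]
  exact (((cw_lin _).xor (xc_lin a)).xor ((conj_lin _ _).comp (cw_lin _))) x y

/-! ### II.3 Reduction and combinations -/

/-- `red [] x = x`. [folklore] -/
theorem red_nil (x : ℕ) : red [] x = x := rfl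

/-- Unfolding of sequential reduction `red` on a non-empty basis. [folklore] -/
theorem red_cons (pb : ℕ × ℕ) (B : List (ℕ × ℕ)) (x : ℕ) :
    red (pb :: B) x = red B (bif x.testBit pb.1 then x ^^^ pb.2 else x) := rfl

/-- One reduction step against `(p, v)`: XOR with `v` iff bit `p` is set. [folklore] -/
theorem step_eq (t : Bool) (x b : ℕ) : (bif t then x ^^^ b else x) = x ^^^ (bif t then b else 0) := by
  cases t <;> simp

/-- Sequential reduction `red B` against a basis list is XOR-linear. [folklore] -/
theorem red_lin : ∀ B : List (ℕ × ℕ), IsLin (red B)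
  | [] => fun _ _ => rfl
  | pb :: B => by
      intro x y
      simp only [red_cons, step_eq]
      rw [sel_xor, ← xor4]
      exact red_lin B _ _

/-- Reduction against `B₁ ++ B₂` is reduction against `B₁` then `B₂`. [folklore] -/
theorem red_append (B C : List (ℕ × ℕ)) (x : ℕ) : red (B ++ C) x = red C (red B x) := by
  simp [red, List.foldl_append]

/-- `comb [] t = 0`. [folklore] -/
theorem comb_nil (t : ℕ) : comb [] t = 0 := rfl

/-- Unfolding of `comb (v :: L) t`: bit `0` of `t` selects `v`, the rest selects from `L`. [folklore] -/
theorem comb_cons (v : ℕ) (L : List ℕ) (t : ℕ) :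
    comb (v :: L) t = (bif t.testBit 0 then v else 0) ^^^ comb L (t >>> 1) := rfl

/-- `comb L` is XOR-linear in the selection mask. [folklore] -/
theorem comb_lin : ∀ L : List ℕ, IsLin (comb L)
  | [] => fun _ _ => by simp [comb]
  | v :: L => by
      intro t u
      simp only [comb_cons]
      rw [sel_xor, shiftRight_xor', comb_lin L, xor4]

/-- `comb L 0 = 0`. [folklore] -/
theorem comb_zero : ∀ L : List ℕ, comb L 0 = 0
  | [] => rfl
  | v :: L => by simp only [comb_cons, Nat.zero_testBit, cond_false, Nat.zero_shiftRight, comb_zero L,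
      Nat.xor_self]

/-- A linear map is determined on combinations by its values on the list. [folklore] -/
theorem IsLin.map_comb {f : ℕ → ℕ} (hf : IsLin f) : ∀ (L : List ℕ) (t : ℕ),
    f (comb L t) = comb (L.map f) t
  | [], _ => by simp [comb, hf.map_zero]
  | v :: L, t => by
      simp only [comb_cons, List.map_cons]
      rw [hf, hf.map_comb L]
      congr 1
      cases t.testBit 0 <;> simp [hf.map_zero]

/-- A linear map vanishing on a list vanishes on its combinations. [folklore] -/
theorem IsLin.comb_eq_zero {f : ℕ → ℕ} (hf : IsLin f) {L : List ℕ} (h : ∀ v ∈ L, f v = 0) (t : ℕ) :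
    f (comb L t) = 0 := by
  induction L generalizing t with
  | nil => simp [comb, hf.map_zero]
  | cons v L ih =>
    simp only [comb_cons]
    rw [hf, ih (fun w hw => h w (List.mem_cons_of_mem _ hw))]
    have hv := h v (List.mem_cons_self ..)
    cases t.testBit 0 <;> simp [hv, hf.map_zero]

/-- `(2n) >>> 1 = n`. [folklore] -/
theorem two_mul_shiftRight_one (t : ℕ) : (2 * t) >>> 1 = t := by
  rw [Nat.shiftRight_eq_div_pow]; omega

/-- `(2n+1) >>> 1 = n`. [folklore] -/
theorem two_mul_add_one_shiftRight_one (t : ℕ) : (2 * t + 1) >>> 1 = t := by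
  rw [Nat.shiftRight_eq_div_pow]; omega

/-- Bit `0` of `2n` is `false`. [folklore] -/
theorem testBit_two_mul_zero (t : ℕ) : (2 * t).testBit 0 = false := by
  simp [Nat.testBit_zero]

/-- Bit `0` of `2n+1` is `true`. [folklore] -/
theorem testBit_two_mul_add_one_zero (t : ℕ) : (2 * t + 1).testBit 0 = true := by
  simp [Nat.testBit_zero]

/-- `comb (v :: L) (2t) = comb L t`. [folklore] -/
theorem comb_cons_two_mul (v : ℕ) (L : List ℕ) (t : ℕ) : comb (v :: L) (2 * t) = comb L t := by
  rw [comb_cons, testBit_two_mul_zero, two_mul_shiftRight_one]; simp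

/-- `comb (v :: L) (2t+1) = v ⊕ comb L t`. [folklore] -/
theorem comb_cons_two_mul_add_one (v : ℕ) (L : List ℕ) (t : ℕ) :
    comb (v :: L) (2 * t + 1) = v ^^^ comb L t := by
  rw [comb_cons, testBit_two_mul_add_one_zero, two_mul_add_one_shiftRight_one]; simp

/-- `comb (L₁ ++ L₂) t = comb L₁ t ⊕ comb L₂ (t >>> |L₁|)`. [folklore] -/
theorem comb_append (L₁ L₂ : List ℕ) (t : ℕ) :
    comb (L₁ ++ L₂) t = comb L₁ t ^^^ comb L₂ (t >>> L₁.length) := by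
  induction L₁ generalizing t with
  | nil => simp [comb]
  | cons v L ih =>
    simp only [List.cons_append, comb_cons, ih, List.length_cons]
    rw [Nat.xor_assoc, ← Nat.shiftRight_add, Nat.add_comm]

/-- `(t % 2ⁿ⁺¹) >>> 1 = (t >>> 1) % 2ⁿ`. [folklore] -/
theorem mod_two_pow_succ_shiftRight (t n : ℕ) : (t % 2 ^ (n + 1)) >>> 1 = (t >>> 1) % 2 ^ n := by
  apply Nat.eq_of_testBit_eq; intro i
  simp only [Nat.testBit_shiftRight, Nat.testBit_mod_two_pow]
  by_cases h : i < n
  · have h' : 1 + i < n + 1 := by omega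
    simp [h, h']
  · have h' : ¬ 1 + i < n + 1 := by omega
    simp [h, h']

/-- `comb L` only reads the low `|L|` bits of the mask. [folklore] -/
theorem comb_mod : ∀ (L : List ℕ) (t : ℕ), comb L (t % 2 ^ L.length) = comb L t
  | [], t => by simp [comb]
  | v :: L, t => by
      simp only [comb_cons, List.length_cons]
      rw [mod_two_pow_succ_shiftRight, comb_mod L]
      congr 1
      simp

/-! ### II.4 Spans -/

/-- `x` lies in the `𝔽₂`-span of the vectors `L`. [folklore] -/
def InSpan (L : List ℕ) (x : ℕ) : Prop := ∃ t, comb L t = x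

/-- `0` is in every span. [folklore] -/
theorem InSpan.zero (L : List ℕ) : InSpan L 0 := ⟨0, comb_zero L⟩

/-- Spans are closed under XOR. [folklore] -/
theorem InSpan.xor {L : List ℕ} {x y : ℕ} (hx : InSpan L x) (hy : InSpan L y) : InSpan L (x ^^^ y) := by
  obtain ⟨t, rfl⟩ := hx; obtain ⟨u, rfl⟩ := hy
  exact ⟨t ^^^ u, comb_lin L t u⟩

/-- The span of `L` is contained in the span of `v :: L`. [folklore] -/
theorem InSpan.tail {L : List ℕ} {x : ℕ} (v : ℕ) (hx : InSpan L x) : InSpan (v :: L) x := by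
  obtain ⟨t, rfl⟩ := hx
  exact ⟨2 * t, comb_cons_two_mul v L t⟩

/-- `v ∈ span(v :: L)`. [folklore] -/
theorem InSpan.head (v : ℕ) (L : List ℕ) : InSpan (v :: L) v :=
  ⟨1, by rw [show (1 : ℕ) = 2 * 0 + 1 from rfl, comb_cons_two_mul_add_one, comb_zero, Nat.xor_zero]⟩

/-- Every list member is in the span. [folklore] -/
theorem InSpan.of_mem {L : List ℕ} {v : ℕ} (hv : v ∈ L) : InSpan L v := by
  induction L with
  | nil => cases hv
  | cons w L ih =>
    rcases List.mem_cons.mp hv with rfl | h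
    · exact InSpan.head _ _
    · exact (ih h).tail w

/-- Spans are closed under `bif`-masking. [folklore] -/
theorem InSpan.cond {L : List ℕ} {v : ℕ} (c : Bool) (hv : InSpan L v) : InSpan L (bif c then v else 0) := by
  cases c
  · exact InSpan.zero L
  · exact hv

/-- Combinations of vectors in a span stay in the span. [folklore] -/
theorem InSpan.comb_mem {L M : List ℕ} (h : ∀ v ∈ L, InSpan M v) (t : ℕ) : InSpan M (comb L t) := by
  induction L generalizing t with
  | nil => exact InSpan.zero M
  | cons v L ih =>
    rw [comb_cons]
    exact ((h v (List.mem_cons_self ..)).cond _).xor (ih (fun w hw => h w (List.mem_cons_of_mem _ hw)) _)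

/-- Monotonicity of spans: if every vector of `L₁` is in `span L₂` then `span L₁ ⊆ span L₂`. [folklore] -/
theorem InSpan.mono {L M : List ℕ} (h : ∀ v ∈ L, InSpan M v) {x : ℕ} (hx : InSpan L x) : InSpan M x := by
  obtain ⟨t, rfl⟩ := hx; exact InSpan.comb_mem h t

/-- An element of `span(L₁ ++ L₂)` is a sum of an element of `span L₁` and one of `span L₂`. [folklore] -/
theorem InSpan.append_split {L₁ L₂ : List ℕ} {x : ℕ} (hx : InSpan (L₁ ++ L₂) x) :
    ∃ t₂, t₂ < 2 ^ L₂.length ∧ InSpan L₁ (x ^^^ comb L₂ t₂) := by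
  obtain ⟨t, rfl⟩ := hx
  refine ⟨(t >>> L₁.length) % 2 ^ L₂.length, Nat.mod_lt _ (Nat.two_pow_pos _), t, ?_⟩
  rw [comb_mod, comb_append, Nat.xor_assoc, Nat.xor_self, Nat.xor_zero]

/-- The image of a span under a linear map. [folklore] -/
theorem InSpan.map {f : ℕ → ℕ} (hf : IsLin f) {L : List ℕ} {x : ℕ} (hx : InSpan L x) :
    InSpan (L.map f) (f x) := by
  obtain ⟨t, rfl⟩ := hx; exact ⟨t, (hf.map_comb L t).symm⟩

/-- R1: a vector differs from its reduction by an element of the span; in particular a vector reducing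
to `0` is in the span. [folklore] -/
theorem xor_aux1 (x s r : ℕ) : x ^^^ r = s ^^^ ((x ^^^ s) ^^^ r) := by
  apply Nat.eq_of_testBit_eq; intro i
  simp only [Nat.testBit_xor]
  cases x.testBit i <;> cases s.testBit i <;> cases r.testBit i <;> rfl

/-- `x ⊕ red B x ∈ span(vecs B)` (reduction subtracts basis vectors). [folklore] -/
theorem inSpan_xor_red : ∀ (B : List (ℕ × ℕ)) (x : ℕ), InSpan (vecs B) (x ^^^ red B x)
  | [], x => by rw [red_nil, Nat.xor_self]; exact InSpan.zero _
  | (p, b) :: B, x => by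
      rw [red_cons]
      dsimp only
      rw [step_eq]
      have ih := inSpan_xor_red B (x ^^^ (bif x.testBit p then b else 0))
      have hmem : InSpan (vecs ((p, b) :: B)) (bif x.testBit p then b else 0) :=
        (InSpan.head b (vecs B)).cond _
      rw [xor_aux1 x (bif x.testBit p then b else 0) (red B (x ^^^ (bif x.testBit p then b else 0)))]
      exact hmem.xor (ih.tail b)

/-- SOUNDNESS OF REDUCTION: `red B x = 0 → x ∈ span(vecs B)`. [folklore] -/
theorem inSpan_of_red_eq_zero {B : List (ℕ × ℕ)} {x : ℕ} (h : red B x = 0) : InSpan (vecs B) x := by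
  have := inSpan_xor_red B x; rwa [h, Nat.xor_zero] at this

/-- R2: a self-reducing list reduces every element of its span to `0`; more generally reduction by `B`
kills the span of any list of vectors that `B` reduces to `0`. [folklore] -/
theorem red_eq_zero_of_inSpan {B : List (ℕ × ℕ)} {L : List ℕ} (hL : ∀ v ∈ L, red B v = 0) {x : ℕ}
    (hx : InSpan L x) : red B x = 0 := by
  obtain ⟨t, rfl⟩ := hx; exact (red_lin B).comb_eq_zero hL t

/-- The characterisation of the span of a self-reducing list by reduction to `0`. [folklore] -/
theorem red_eq_zero_iff {B : List (ℕ × ℕ)} (hB : ∀ v ∈ vecs B, red B v = 0) (x : ℕ) :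
    red B x = 0 ↔ InSpan (vecs B) x :=
  ⟨inSpan_of_red_eq_zero, red_eq_zero_of_inSpan hB⟩

/-- Every `x < 2^n` is in the span of any list containing (spanning) the unit vectors `2^i`, `i < n`. [folklore] -/
theorem inSpan_of_lt_two_pow {L : List ℕ} {n : ℕ} (hL : ∀ i < n, InSpan L (2 ^ i)) {x : ℕ}
    (hx : x < 2 ^ n) : InSpan L x := by
  induction n generalizing x with
  | zero => have : x = 0 := by omega
            subst this; exact InSpan.zero L
  | succ n ih =>
    have hsplit : x = x % 2 ^ n ^^^ (bif x.testBit n then 2 ^ n else 0) := by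
      apply Nat.eq_of_testBit_eq; intro i
      simp only [Nat.testBit_xor, Nat.testBit_mod_two_pow]
      rcases Nat.lt_trichotomy i n with hi | rfl | hi
      · have : (bif x.testBit n then 2 ^ n else 0).testBit i = false := by
          cases x.testBit n <;> simp [hi.ne']
        simp [hi, this]
      · cases h : x.testBit i <;> simp [Nat.testBit_two_pow_self]
      · have hxi : x.testBit i = false :=
          Nat.testBit_lt_two_pow (lt_of_lt_of_le hx (Nat.pow_le_pow_right (by norm_num) hi))
        have : (bif x.testBit n then 2 ^ n else 0).testBit i = false := by
          cases x.testBit n <;> simp [hi.ne]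
        simp [hxi, this, Nat.not_lt.mpr hi.le]
    rw [hsplit]
    exact (ih (fun i hi => hL i (Nat.lt_succ_of_lt hi)) (Nat.mod_lt _ (Nat.two_pow_pos n))).xor
      ((hL n (Nat.lt_succ_self n)).cond _)

/-- THE COMPLETENESS PRINCIPLE: if `B ++ C` spans a space containing `x`, a linear "syndrome" `f`
vanishes on `B` and on `x`, and no non-zero combination of `C` has zero syndrome, then `x ∈ span(B)`. [folklore] -/
theorem inSpan_of_syndrome {B C : List ℕ} {f : ℕ → ℕ} (hf : IsLin f) (hB : ∀ v ∈ B, f v = 0)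
    (hC : ∀ t < 2 ^ C.length, t ≠ 0 → f (comb C t) ≠ 0) {x : ℕ} (hx : InSpan (B ++ C) x)
    (hfx : f x = 0) : InSpan B x := by
  obtain ⟨t₂, ht₂, hsp⟩ := hx.append_split
  have h1 : f (x ^^^ comb C t₂) = 0 := by
    obtain ⟨t, ht⟩ := hsp; rw [← ht]; exact hf.comb_eq_zero hB t
  rw [hf, hfx, Nat.zero_xor] at h1
  by_cases ht : t₂ = 0
  · subst ht; rwa [comb_zero, Nat.xor_zero] at hsp
  · exact absurd h1 (hC t₂ ht₂ ht)

end LinAlg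

section Meaning

/-! ### II.5 MEANING of the `𝔰` certificate: `a ∈ 𝔰𝔭₄(𝔽₂) ↔ a ∈ span(sB)` for every code `a` -/

/-- The symmetry-defect selector is additive for XOR. [folklore] -/
theorem pairSel_xor (p q w x y : ℕ) :
    (bif (x ^^^ y).testBit p == (x ^^^ y).testBit q then 0 else w) =
    (bif x.testBit p == x.testBit q then 0 else w) ^^^ (bif y.testBit p == y.testBit q then 0 else w) := by
  simp only [Nat.testBit_xor]
  cases x.testBit p <;> cases x.testBit q <;> cases y.testBit p <;> cases y.testBit q <;> simp

/-- The symmetry-defect selector `pairSel i j` is XOR-linear. [folklore] -/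
theorem pairSel_lin {h : ℕ → ℕ} (hh : IsLin h) (p q w : ℕ) :
    IsLin (fun x => bif (h x).testBit p == (h x).testBit q then 0 else w) := by
  intro x y; simp only [hh x y]; exact pairSel_xor p q w (h x) (h y)

/-- The symmetry defect `a ↦ (Ja)ᵀ + Ja` (packed) is `𝔽₂`-linear. [folklore] -/
theorem symSyn_lin : IsLin symSyn := by
  intro x y
  simp only [symSyn]
  exact ((((((pairSel_lin (mmul_lin_right cJ) 1 4 1).xor (pairSel_lin (mmul_lin_right cJ) 2 8 2)).xor
    (pairSel_lin (mmul_lin_right cJ) 3 12 4)).xor (pairSel_lin (mmul_lin_right cJ) 6 9 8)).xor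
    (pairSel_lin (mmul_lin_right cJ) 7 13 16)).xor (pairSel_lin (mmul_lin_right cJ) 11 14 32)) x y

/-- MEANING of `check_sB`: the `sB` vectors are `< 2¹⁶`, lie in `𝔰`, and `sB` is self-reducing. [folklore] -/
theorem sB_facts (b : ℕ) (hb : b ∈ vecs sB) : symSyn b = 0 ∧ red sB b = 0 ∧
    red sB (conj cG0 cG0i b) = 0 ∧ red sB (conj cG1 cG1i b) = 0 ∧
    red sB (conj cG0i cG0 b) = 0 ∧ red sB (conj cG1i cG1 b) = 0 := by
  have := List.all_eq_true.mp check_sB.1 b hb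
  simp only [inS, Bool.and_eq_true, beq_iff_eq] at this
  obtain ⟨⟨⟨⟨⟨h1, h2⟩, h3⟩, h4⟩, h5⟩, h6⟩ := this
  exact ⟨h1, h2, h3, h4, h5, h6⟩

/-- `vecs (B₁ ++ B₂) = vecs B₁ ++ vecs B₂`. [folklore] -/
theorem vecs_append (B C : List (ℕ × ℕ)) : vecs (B ++ C) = vecs B ++ vecs C := by simp [vecs]

/-- MEANING (`𝔰`, Part I §D): for every code `a < 2¹⁶`, `a ∈ 𝔰𝔭₄(𝔽₂)` (i.e. `(Ja)ᵀ = Ja`) iff `a` reduces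
to `0` modulo the basis `sB`, iff `a ∈ span(sB)`; so `𝔰 = span(sB)` has exactly `2¹⁰` elements `sElt t`. [folklore] -/
theorem inS_iff_red_sB (a : ℕ) (ha : a < 65536) : inS a = true ↔ red sB a = 0 := by
  have hBred : ∀ v ∈ vecs sB, red sB v = 0 := fun v hv => (sB_facts v hv).2.1
  constructor
  · intro h
    have hsyn : symSyn a = 0 := by simpa [inS] using h
    apply red_eq_zero_of_inSpan hBred
    have hunits : ∀ i < 16, InSpan (vecs (sB ++ SC)) (2 ^ i) := fun i hi =>
      inSpan_of_red_eq_zero (by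
        have := List.all_eq_true.mp check_sC.1 i (List.mem_range.mpr hi)
        simpa using this)
    have hx : InSpan (vecs sB ++ vecs SC) a := by
      rw [← vecs_append]
      exact inSpan_of_lt_two_pow hunits (by norm_num; exact ha)
    refine inSpan_of_syndrome symSyn_lin (fun v hv => (sB_facts v hv).1) ?_ hx hsyn
    intro t ht ht0
    have hlen : (vecs SC).length = 6 := rfl
    rw [hlen] at ht
    have := List.all_eq_true.mp check_sC.2 t (List.mem_range.mpr (by norm_num at ht; exact ht))
    simpa [ht0] using this
  · intro h
    have : symSyn a = 0 := by
      obtain ⟨t, rfl⟩ := inSpan_of_red_eq_zero h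
      exact symSyn_lin.comb_eq_zero (fun v hv => (sB_facts v hv).1) t
    simp [inS, this]

/-- … equivalently `a ∈ span(sB)`. [folklore] -/
theorem inS_iff_inSpan (a : ℕ) (ha : a < 65536) : inS a = true ↔ InSpan (vecs sB) a := by
  rw [inS_iff_red_sB a ha, red_eq_zero_iff (fun v hv => (sB_facts v hv).2.1)]

/-! ### II.6 Size bounds -/

/-- `bif c then v else 0 < n` when `v < n` (and `0 < n`). [folklore] -/
theorem cond_lt {c : Bool} {v n : ℕ} (hv : v < n) : (bif c then v else 0) < n := by
  cases c
  · exact lt_of_le_of_lt (Nat.zero_le _) hv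
  · exact hv

/-- A row of a code is `< 16`. [folklore] -/
theorem row_lt (a i : ℕ) : row a i < 2 ^ 4 := Nat.mod_lt _ (by norm_num)

/-- `rowMul r b < 16`. [folklore] -/
theorem rowMul_lt (r b : ℕ) : rowMul r b < 2 ^ 4 := by
  unfold rowMul
  exact xor_lt_two_pow' (xor_lt_two_pow' (xor_lt_two_pow' (cond_lt (row_lt _ _)) (cond_lt (row_lt _ _)))
    (cond_lt (row_lt _ _))) (cond_lt (row_lt _ _))

/-- `x < 2ᵐ → x <<< k < 2^(m+k)`-type bound used for packing rows. [folklore] -/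
theorem shiftLeft_lt {r k n : ℕ} (hr : r < 2 ^ (n - k)) (hk : k ≤ n) : r <<< k < 2 ^ n := by
  rw [Nat.shiftLeft_eq]
  calc r * 2 ^ k < 2 ^ (n - k) * 2 ^ k := Nat.mul_lt_mul_of_pos_right hr (Nat.two_pow_pos k)
    _ = 2 ^ n := by rw [← Nat.pow_add, Nat.sub_add_cancel hk]

/-- `mmul a b < 2¹⁶`. [folklore] -/
theorem mmul_lt (a b : ℕ) : mmul a b < 65536 := by
  rw [show (65536 : ℕ) = 2 ^ 16 by norm_num]
  unfold mmul
  refine xor_lt_two_pow' (xor_lt_two_pow' (xor_lt_two_pow' ?_ ?_) ?_) ?_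
  · exact lt_of_lt_of_le (rowMul_lt _ _) (Nat.pow_le_pow_right (by norm_num) (by norm_num))
  · exact shiftLeft_lt (lt_of_lt_of_le (rowMul_lt _ _) (Nat.pow_le_pow_right (by norm_num) (by norm_num)))
      (by norm_num)
  · exact shiftLeft_lt (lt_of_lt_of_le (rowMul_lt _ _) (Nat.pow_le_pow_right (by norm_num) (by norm_num)))
      (by norm_num)
  · exact shiftLeft_lt (rowMul_lt _ _) (by norm_num)

/-- `conj g gi x < 2¹⁶`. [folklore] -/
theorem conj_lt (g gi a : ℕ) : conj g gi a < 65536 := mmul_lt _ _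

/-- XOR preserves `< 2¹⁶`. [folklore] -/
theorem xor_lt_65536 {a b : ℕ} (ha : a < 65536) (hb : b < 65536) : a ^^^ b < 65536 := by
  rw [show (65536 : ℕ) = 2 ^ 16 by norm_num] at *; exact xor_lt_two_pow' ha hb

/-- Reduction against a basis of vectors `< 2¹⁶` preserves `< 2¹⁶`. [folklore] -/
theorem red_lt {B : List (ℕ × ℕ)} {n : ℕ} (hB : ∀ v ∈ vecs B, v < 2 ^ n) {x : ℕ} (hx : x < 2 ^ n) :
    red B x < 2 ^ n := by
  induction B generalizing x with
  | nil => exact hx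
  | cons pb B ih =>
    rw [red_cons]
    apply ih (fun v hv => hB v (List.mem_cons_of_mem _ hv))
    cases x.testBit pb.1
    · exact hx
    · exact xor_lt_two_pow' hx (hB _ (List.mem_cons_self ..))

/-- The `sB` vectors are `< 2¹⁶`. [folklore] -/
theorem sB_lt : ∀ v ∈ vecs sB, v < 2 ^ 16 := by decide

/-- `x < 2¹⁶ → red sB x < 2¹⁶`. [folklore] -/
theorem red_sB_lt {x : ℕ} (hx : x < 65536) : red sB x < 65536 := by
  rw [show (65536 : ℕ) = 2 ^ 16 by norm_num] at *; exact red_lt sB_lt hx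

/-! ### II.7 MEANING of the admissibility certificate: `m` admissible `↔ m ∈ span(admB)` -/

/-- The admissibility syndrome is `𝔽₂`-linear. [folklore] -/
theorem admSyn_lin : IsLin admSyn := by
  intro x y
  simp only [admSyn]
  exact (((red_lin sB).comp (IsLin.id.xor (conj_lin cG0 cG0i))).xor
    ((IsLin.shiftLeft 16).comp ((red_lin sB).comp (IsLin.id.xor (conj_lin cG1 cG1i))))) x y

/-- `a ⊕ (b <<< 16) = 0` with `a < 2¹⁶` forces `a = 0 ∧ b = 0`. [folklore] -/
theorem xor_shiftLeft16_eq_zero {a b : ℕ} (ha : a < 65536) (h : a ^^^ (b <<< 16) = 0) : a = 0 ∧ b = 0 := by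
  rw [xor_eq_zero_iff_eq, Nat.shiftLeft_eq] at h
  norm_num at h
  omega

/-- `isAdm m ↔ admSyn m = 0` (admissible: `m + g m g⁻¹ ∈ 𝔰` for both generators `g` of `G`). [folklore] -/
theorem isAdm_iff_admSyn (m : ℕ) (hm : m < 65536) : isAdm m = true ↔ admSyn m = 0 := by
  have h0 : m ^^^ conj cG0 cG0i m < 65536 := xor_lt_65536 hm (conj_lt ..)
  have h1 : m ^^^ conj cG1 cG1i m < 65536 := xor_lt_65536 hm (conj_lt ..)
  simp only [isAdm, Bool.and_eq_true, inS_iff_red_sB _ h0, inS_iff_red_sB _ h1, admSyn]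
  constructor
  · rintro ⟨ha, hb⟩; rw [ha, hb]; rfl
  · intro h
    exact xor_shiftLeft16_eq_zero (red_sB_lt h0) h

/-- MEANING of `check_adm`: the `admB` vectors are `< 2¹⁶`, admissible, and `admB` is self-reducing. [folklore] -/
theorem admB_facts (m : ℕ) (hm : m ∈ vecs admB) : isAdm m = true ∧ red admB m = 0 ∧ admSyn m = 0 := by
  have h1 := List.all_eq_true.mp check_adm.1 m hm
  have h2 := List.all_eq_true.mp check_admC.2.1 m hm
  simp only [Bool.and_eq_true, beq_iff_eq] at h1 h2
  exact ⟨h1.1, h1.2, h2⟩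

/-- MEANING (admissible set, Part I §G): for every code `m < 2¹⁶`, `m` is admissible (`m + g m g⁻¹ ∈ 𝔰` for
`g = g₀, g₁`, hence — by the cocycle identity — for all `g ∈ G`) iff `m` reduces to `0` modulo `admB`, iff
`m ∈ span(admB)`; so the admissible matrices form the `2¹¹`-element space `span(admB) = 𝔰 ⊕ ⟨diag(1,1,0,0)⟩`. [folklore] -/
theorem isAdm_iff_red_admB (m : ℕ) (hm : m < 65536) : isAdm m = true ↔ red admB m = 0 := by
  have hBred : ∀ v ∈ vecs admB, red admB v = 0 := fun v hv => (admB_facts v hv).2.1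
  rw [isAdm_iff_admSyn m hm]
  constructor
  · intro hsyn
    apply red_eq_zero_of_inSpan hBred
    have hunits : ∀ i < 16, InSpan (vecs (admB ++ AC)) (2 ^ i) := fun i hi =>
      inSpan_of_red_eq_zero (by
        have := List.all_eq_true.mp check_admC.1 i (List.mem_range.mpr hi)
        simpa using this)
    have hx : InSpan (vecs admB ++ vecs AC) m := by
      rw [← vecs_append]
      exact inSpan_of_lt_two_pow hunits (by norm_num; exact hm)
    refine inSpan_of_syndrome admSyn_lin (fun v hv => (admB_facts v hv).2.2) ?_ hx hsyn
    intro t ht ht0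
    have hlen : (vecs AC).length = 5 := rfl
    rw [hlen] at ht
    have := List.all_eq_true.mp check_admC.2.2 t (List.mem_range.mpr (by norm_num at ht; exact ht))
    simpa [ht0] using this
  · intro h
    obtain ⟨t, rfl⟩ := inSpan_of_red_eq_zero h
    exact admSyn_lin.comb_eq_zero (fun v hv => (admB_facts v hv).2.2) t

/-- `𝔰 ⊆` admissible and `diag(1,1,0,0)` is admissible (as span membership). [folklore] -/
theorem sB_sub_admB : ∀ m ∈ cDiag1100 :: vecs sB, red admB m = 0 := by
  intro m hm
  have := List.all_eq_true.mp check_adm.2 m hm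
  simpa using this

/-! ### II.8 MEANING of the cocycle certificates: `Sol(V) = span(SOLB j)` -/

/-- The literal `units2` reducer is `pairsOf sB`. [folklore] -/
theorem units2_eq : units2 = pairsOf sB := by decide

/-- Case split of `j < 8`. [folklore] -/
theorem lt_eight {j : ℕ} (hj : j < 8) : j = 0 ∨ j = 1 ∨ j = 2 ∨ j = 3 ∨ j = 4 ∨ j = 5 ∨ j = 6 ∨ j = 7 := by
  omega

/-- Dispatcher: `check_sol_j` for a variable `j < 8`. [folklore] -/
theorem check_sol (j : ℕ) (hj : j < 8) : ((vecs (ZB j)).all fun z => isSol j z) = true ∧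
    ((vecs (SOLB j)).all fun z => red (SOLB j) z == 0) = true := by
  rcases lt_eight hj with rfl | rfl | rfl | rfl | rfl | rfl | rfl | rfl
  exacts [check_sol_0, check_sol_1, check_sol_2, check_sol_3, check_sol_4, check_sol_5, check_sol_6,
    check_sol_7]

/-- Conversion between the two spellings of a bounded `List.all` over `List.range`. [folklore] -/
theorem range_all_conv {N : ℕ} {P : List ℕ} (h : ((List.range N).all fun t => t == 0 || comb P t != 0) = true)
    (hN : N = 2 ^ P.length) : ∀ t < 2 ^ P.length, t ≠ 0 → comb P t ≠ 0 := by
  intro t ht ht0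
  have := List.all_eq_true.mp h t (List.mem_range.mpr (hN ▸ ht))
  simpa [ht0] using this

/-- Dispatcher: `check_cmp_j` for a variable `j < 8`. [folklore] -/
theorem check_cmp (j : ℕ) (hj : j < 8) : ((vecs (CMPB j)).all fun z => red units2 z == 0) = true ∧
    ((vecs units2).all fun u => red (SOLB j ++ CMPB j) u == 0) = true ∧
    (vecs (CMPB j)).map (synBits j) = SYNPAT j ∧
    (∀ t < 2 ^ (SYNPAT j).length, t ≠ 0 → comb (SYNPAT j) t ≠ 0) := by
  rcases lt_eight hj with rfl | rfl | rfl | rfl | rfl | rfl | rfl | rfl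
  · exact ⟨check_cmp_0.1, check_cmp_0.2.1, check_cmp_0.2.2.1, range_all_conv check_cmp_0.2.2.2 (by decide)⟩
  · exact ⟨check_cmp_1.1, check_cmp_1.2.1, check_cmp_1.2.2.1, range_all_conv check_cmp_1.2.2.2 (by decide)⟩
  · exact ⟨check_cmp_2.1, check_cmp_2.2.1, check_cmp_2.2.2.1, range_all_conv check_cmp_2.2.2.2 (by decide)⟩
  · exact ⟨check_cmp_3.1, check_cmp_3.2.1, check_cmp_3.2.2.1, range_all_conv check_cmp_3.2.2.2 (by decide)⟩
  · exact ⟨check_cmp_4.1, check_cmp_4.2.1, check_cmp_4.2.2.1, range_all_conv check_cmp_4.2.2.2 (by decide)⟩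
  · exact ⟨check_cmp_5.1, check_cmp_5.2.1, check_cmp_5.2.2.1, range_all_conv check_cmp_5.2.2.2 (by decide)⟩
  · exact ⟨check_cmp_6.1, check_cmp_6.2.1, check_cmp_6.2.2.1, range_all_conv check_cmp_6.2.2.2 (by decide)⟩
  · exact ⟨check_cmp_7.1, check_cmp_7.2.1, check_cmp_7.2.2.1, range_all_conv check_cmp_7.2.2.2 (by decide)⟩

/-- The table facts of Part I §C, unpacked. [folklore] -/
theorem EL_facts (k : ℕ) (hk : k < 120) : el k = evalC (wordAt k) ∧ mmul (el k) (eli k) = cI ∧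
    mmul (eli k) (el k) = cI ∧ ∀ a < 2, nxt a k < 120 ∧ evalC (wordAt (nxt a k)) = mmul (gN a) (el k) ∧
      (isTree a k = true ↔ (wordAt (nxt a k)).map Fin.val = a :: (wordAt k).map Fin.val) := by
  have h := List.all_eq_true.mp check_EL k (List.mem_range.mpr hk)
  simp only [Bool.and_eq_true, beq_iff_eq, List.all_eq_true, List.mem_range, decide_eq_true_eq] at h
  obtain ⟨⟨⟨h1, h2⟩, h3⟩, h4⟩ := h
  refine ⟨h1, h2, h3, fun a ha => ?_⟩
  obtain ⟨⟨h5, h6⟩, h7⟩ := h4 a ha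
  refine ⟨h5, h6, ?_⟩
  rw [h7]; exact beq_iff_eq

/-- A four-term XOR regrouping identity. [folklore] -/
theorem xor_aux2 (p q : ℕ) : (p ^^^ q) ^^^ p ^^^ q = 0 := by
  apply Nat.eq_of_testBit_eq; intro i
  simp only [Nat.testBit_xor, Nat.zero_testBit]
  cases p.testBit i <;> cases q.testBit i <;> rfl

/-- On a TREE EDGE the defect vanishes identically (the normal form of `g_a · e_k` is the word `a :: word k`,
and `cw` is defined by exactly that recursion). [folklore] -/
theorem defect_tree {z a k : ℕ} (ha : a < 2) (hk : k < 120) (ht : isTree a k = true) : defect z a k = 0 := by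
  obtain ⟨-, -, -, hall⟩ := EL_facts k hk
  obtain ⟨-, -, htree⟩ := hall a ha
  have hw : wordAt (nxt a k) = (⟨a, ha⟩ : Fin 2) :: wordAt k := by
    apply List.map_injective_iff.mpr Fin.val_injective
    simpa using htree.mp ht
  unfold defect
  rw [hw]
  simp only [cw]
  exact xor_aux2 _ _

/-- MEANING of `check_VB`: the `VB j` vectors lie in `𝔰`, are `< 2¹⁶`, self-reducing, and have generator-conjugates reducing to `0`. [folklore] -/
theorem VB_facts (j : ℕ) (hj : j < 8) (b : ℕ) (hb : b ∈ vecs (VB j)) : red sB b = 0 ∧ red (VB j) b = 0 ∧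
    red (VB j) (conj cG0 cG0i b) = 0 ∧ red (VB j) (conj cG1 cG1i b) = 0 := by
  have h := List.all_eq_true.mp (List.all_eq_true.mp check_VB.1 j (List.mem_range.mpr hj)) b hb
  simp only [Bool.and_eq_true, beq_iff_eq] at h
  obtain ⟨⟨⟨h1, h2⟩, h3⟩, h4⟩ := h
  exact ⟨h1, h2, h3, h4⟩

/-- `span(VB j)` is stable under conjugation by the generators (hence a `G`-submodule). [folklore] -/
theorem VB_conj_closed (j : ℕ) (hj : j < 8) {x : ℕ} (hx : red (VB j) x = 0) (a : ℕ) :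
    red (VB j) (conj (gN a) (giN a) x) = 0 := by
  obtain ⟨t, rfl⟩ := inSpan_of_red_eq_zero hx
  rw [(conj_lin _ _).map_comb]
  refine red_eq_zero_of_inSpan ?_ ⟨t, rfl⟩
  intro v hv
  obtain ⟨b, hb, rfl⟩ := List.mem_map.mp hv
  by_cases h : a = 0
  · subst h; exact (VB_facts j hj b hb).2.2.1
  · have hb' : (a == 0) = false := by simp [h]
    simp only [gN, giN, hb', cond_false]
    exact (VB_facts j hj b hb).2.2.2

/-- `red B` vanishes on a XOR if it vanishes on both arguments. [folklore] -/
theorem red_xor_eq_zero {B : List (ℕ × ℕ)} {x y : ℕ} (hx : red B x = 0) (hy : red B y = 0) :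
    red B (x ^^^ y) = 0 := by
  rw [red_lin B, hx, hy]; rfl

/-- `red B 0 = 0`. [folklore] -/
theorem red_zero (B : List (ℕ × ℕ)) : red B 0 = 0 := (red_lin B).map_zero

/-- If both components of `z` lie in `span(VB j)`, then so does every value `c(w)` of the word cocycle. [folklore] -/
theorem cw_mem_VB (j : ℕ) (hj : j < 8) {z : ℕ} (h0 : red (VB j) (xc z 0) = 0) (h1 : red (VB j) (xc z 1) = 0) :
    ∀ w, red (VB j) (cw z w) = 0
  | [] => red_zero _
  | b :: w => by
      simp only [cw]
      refine red_xor_eq_zero ?_ (VB_conj_closed j hj (cw_mem_VB j hj h0 h1 w) _)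
      rcases Fin.exists_fin_two.mp ⟨b, rfl⟩ with hb | hb <;> simp only [hb]
      exacts [h0, h1]

/-- `xc a z` for `a ≠ 0` extracts the high component. [folklore] -/
theorem xc_of_ne_zero (z a : ℕ) (ha : a ≠ 0) : xc z a = z >>> 16 := by
  have : (a == 0) = false := by simp [ha]
  simp [xc, this]

/-- … and then every defect lies in `span(VB j)`: the pairs `(v,0)`, `(0,v)`, `v ∈ V`, are in `Sol(V)`. [folklore] -/
theorem defect_mem_VB (j : ℕ) (hj : j < 8) {z : ℕ} (h0 : red (VB j) (xc z 0) = 0)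
    (h1 : red (VB j) (xc z 1) = 0) (a k : ℕ) : red (VB j) (defect z a k) = 0 := by
  unfold defect
  refine red_xor_eq_zero (red_xor_eq_zero (cw_mem_VB j hj h0 h1 _) ?_)
    (VB_conj_closed j hj (cw_mem_VB j hj h0 h1 _) a)
  by_cases ha : a = 0
  · subst ha; exact h0
  · rw [xc_of_ne_zero z a ha, ← xc_of_ne_zero z 1 (by norm_num)]; exact h1

/-- Combinations of vectors `< 2ⁿ` are `< 2ⁿ`. [folklore] -/
theorem comb_lt {L : List ℕ} {n : ℕ} (hL : ∀ v ∈ L, v < 2 ^ n) (t : ℕ) : comb L t < 2 ^ n := by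
  induction L generalizing t with
  | nil => exact Nat.two_pow_pos n
  | cons v L ih =>
    rw [comb_cons]
    exact xor_lt_two_pow' (cond_lt (hL v (List.mem_cons_self ..)))
      (ih (fun w hw => hL w (List.mem_cons_of_mem _ hw)) _)

/-- `red sB x = 0 → x < 2¹⁶` (elements of `𝔰` are codes). [folklore] -/
theorem lt_of_red_sB {x : ℕ} (hx : red sB x = 0) : x < 65536 := by
  obtain ⟨t, rfl⟩ := inSpan_of_red_eq_zero hx
  exact comb_lt sB_lt t

/-- `(b <<< 16) % 2¹⁶ = 0`. [folklore] -/
theorem shiftLeft16_mod (w : ℕ) : (w <<< 16) % 65536 = 0 := by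
  rw [Nat.shiftLeft_eq]; norm_num [Nat.mul_mod_left]

/-- `(b <<< 16) >>> 16 = b`. [folklore] -/
theorem shiftLeft16_shiftRight (w : ℕ) : (w <<< 16) >>> 16 = w := by
  rw [Nat.shiftRight_eq_div_pow, Nat.shiftLeft_eq]; exact Nat.mul_div_cancel w (by norm_num)

/-- `a < 2¹⁶ → a >>> 16 = 0`. [folklore] -/
theorem shiftRight16_of_lt {w : ℕ} (hw : w < 65536) : w >>> 16 = 0 := by
  rw [Nat.shiftRight_eq_div_pow]; exact Nat.div_eq_of_lt (by norm_num; exact hw)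

/-- The vectors of `pairsOf B`: the `B` vectors in the low and in the high component. [folklore] -/
theorem vecs_pairsOf (B : List (ℕ × ℕ)) : vecs (pairsOf B) = (vecs B).map (· <<< 16) ++ vecs B := by
  simp [vecs, pairsOf, List.map_map, Function.comp_def]

/-- `xc 0 z = z % 2¹⁶` (low component). [folklore] -/
theorem xc_zero (z : ℕ) : xc z 0 = z % 65536 := rfl
/-- `xc 1 z = z >>> 16` (high component). [folklore] -/
theorem xc_one (z : ℕ) : xc z 1 = z >>> 16 := rfl

/-- The components of the `SOLB`-type pairs built from `V`. [folklore] -/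
theorem pairsOf_components {j : ℕ} (hj : j < 8) {v : ℕ} (hv : v ∈ vecs (pairsOf (VB j))) :
    red (VB j) (xc v 0) = 0 ∧ red (VB j) (xc v 1) = 0 ∧ red sB (xc v 0) = 0 ∧ red sB (xc v 1) = 0 := by
  rw [vecs_pairsOf, List.mem_append, List.mem_map] at hv
  rcases hv with ⟨w, hw, rfl⟩ | hw
  · have hf := VB_facts j hj w hw
    rw [xc_zero, xc_one, shiftLeft16_mod, shiftLeft16_shiftRight]
    exact ⟨red_zero _, hf.2.1, red_zero _, hf.1⟩
  · have hf := VB_facts j hj v hw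
    have hlt := lt_of_red_sB hf.1
    rw [xc_zero, xc_one, Nat.mod_eq_of_lt hlt, shiftRight16_of_lt hlt]
    exact ⟨hf.2.1, red_zero _, hf.1, red_zero _⟩

/-- MEANING of the `units2` check: `pairsOf sB` is self-reducing with vectors `< 2³²`. [folklore] -/
theorem units2_facts (u : ℕ) (hu : u ∈ vecs units2) : red units2 u = 0 ∧ red sB (u % 65536) = 0 ∧
    red sB (u >>> 16) = 0 := by
  have h := List.all_eq_true.mp check_sB.2.2 u hu
  simp only [Bool.and_eq_true, beq_iff_eq] at h
  exact ⟨h.1.1, h.1.2, h.2⟩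

/-- MEANING of `red units2 z = 0`: both components of the pair `z` lie in `𝔰 = span(sB)` (for `z < 2³²`). [folklore] -/
theorem red_units2_iff (z : ℕ) (hz : z < 2 ^ 32) :
    red units2 z = 0 ↔ red sB (z % 65536) = 0 ∧ red sB (z >>> 16) = 0 := by
  constructor
  · intro h
    obtain ⟨t, rfl⟩ := inSpan_of_red_eq_zero h
    exact ⟨((red_lin sB).comp (IsLin.modPow 16)).comb_eq_zero (fun u hu => (units2_facts u hu).2.1) t,
      ((red_lin sB).comp (IsLin.shiftRight 16)).comb_eq_zero (fun u hu => (units2_facts u hu).2.2) t⟩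
  · rintro ⟨h0, h1⟩
    apply red_eq_zero_of_inSpan (fun u hu => (units2_facts u hu).1)
    have hsplit : z = (z >>> 16) <<< 16 ^^^ z % 65536 := by
      apply Nat.eq_of_testBit_eq; intro i
      rw [show (65536 : ℕ) = 2 ^ 16 by norm_num]
      simp only [Nat.testBit_xor, Nat.testBit_shiftLeft, Nat.testBit_shiftRight, Nat.testBit_mod_two_pow]
      by_cases hi : i ≥ 16
      · have : 16 + (i - 16) = i := by omega
        simp [hi, this, Nat.not_lt.mpr hi]
      · have hi' : i < 16 := by omega
        simp [hi, hi']
    rw [hsplit, units2_eq, vecs_pairsOf]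
    refine InSpan.xor ?_ ?_
    · exact InSpan.mono (fun v hv => InSpan.of_mem (List.mem_append_left _ hv))
        ((inSpan_of_red_eq_zero h1).map (IsLin.shiftLeft 16))
    · exact InSpan.mono (fun v hv => InSpan.of_mem (List.mem_append_right _ hv))
        (inSpan_of_red_eq_zero h0)

/-- Membership in `span(pairsOf sB)` is componentwise membership in `𝔰`. [folklore] -/
theorem pairsOf_units2 {j : ℕ} (hj : j < 8) {v : ℕ} (hv : v ∈ vecs (pairsOf (VB j))) : red units2 v = 0 := by
  have hc := pairsOf_components hj hv
  have hlt : v < 2 ^ 32 := by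
    rw [vecs_pairsOf, List.mem_append, List.mem_map] at hv
    rcases hv with ⟨w, hw, rfl⟩ | hw
    · exact shiftLeft_lt (by simpa using lt_of_red_sB (VB_facts j hj w hw).1) (by norm_num)
    · exact lt_of_lt_of_le (lt_of_red_sB (VB_facts j hj v hw).1) (by norm_num)
  exact (red_units2_iff v hlt).mpr ⟨hc.2.2.1, hc.2.2.2⟩

/-- `z = (x₀,x₁)` is a COCYCLE DATUM modulo `V = span(VB j)`: both components lie in `𝔰` and all `240`
defects `c(g_a e_k) + x_a + g_a c(e_k) g_a⁻¹` lie in `V` — i.e. `w ↦ c(w) mod V` is a crossed homomorphism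
`G → 𝔰/V` (well defined on `G` because the `120` normal-form words are a transversal and the defects at all
`240` generator edges of the Cayley graph vanish mod `V`). [folklore] -/
def IsCocyclePair (j z : ℕ) : Prop :=
  red units2 z = 0 ∧ ∀ a < 2, ∀ k < 120, red (VB j) (defect z a k) = 0

/-- Unfolding of the Boolean cocycle test `isSol`. [folklore] -/
theorem isSol_iff (j z : ℕ) : isSol j z = true ↔
    red units2 z = 0 ∧ ∀ k < 120, ∀ a < 2, isTree a k = true ∨ red (VB j) (defect z a k) = 0 := by
  simp [isSol, List.all_eq_true, List.mem_range, Bool.or_eq_true, beq_iff_eq]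

/-- A packed pair in `𝔰²` passing `isSol j` is a cocycle pair for `VB j`. [folklore] -/
theorem isCocyclePair_of_isSol {j z : ℕ} (h : isSol j z = true) : IsCocyclePair j z := by
  rw [isSol_iff] at h
  refine ⟨h.1, fun a ha k hk => ?_⟩
  rcases h.2 k hk a ha with ht | hd
  · rw [defect_tree ha hk ht]; exact red_zero _
  · exact hd

/-- Every vector of the basis `SOLB j` is a cocycle datum mod `VB j`. [folklore] -/
theorem SOLB_isCocyclePair {j : ℕ} (hj : j < 8) {v : ℕ} (hv : v ∈ vecs (SOLB j)) : IsCocyclePair j v := by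
  rw [SOLB, vecs_append, List.mem_append] at hv
  rcases hv with hv | hv
  · have hc := pairsOf_components hj hv
    exact ⟨pairsOf_units2 hj hv, fun a _ k _ => defect_mem_VB j hj hc.1 hc.2.1 a k⟩
  · exact isCocyclePair_of_isSol (List.all_eq_true.mp (check_sol j hj).1 v hv)

/-! #### Linearity and vanishing of the selected-syndrome map `synBits` -/

/-- Bit `0` of `2n + [t]` is `t`. [folklore] -/
theorem pack_testBit_zero (n : ℕ) (t : Bool) : (2 * n + bif t then 1 else 0).testBit 0 = t := by
  cases t <;> simp [Nat.testBit_zero]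

/-- Bits of a packed Boolean list, successor case. [folklore] -/
theorem pack_testBit_succ (n : ℕ) (t : Bool) (i : ℕ) :
    (2 * n + bif t then 1 else 0).testBit (i + 1) = n.testBit i := by
  cases t
  · show (2 * n + 0).testBit (i + 1) = n.testBit i
    rw [Nat.add_zero, Nat.testBit_succ, Nat.mul_div_cancel_left n (by norm_num : 0 < 2)]
  · show (2 * n + 1).testBit (i + 1) = n.testBit i
    rw [Nat.testBit_succ, Nat.mul_add_div (by norm_num : 0 < 2), show (1 : ℕ) / 2 = 0 from rfl, Nat.add_zero]

/-- Packing Boolean lists commutes with pointwise `xor` / XOR. [folklore] -/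
theorem pack_xor (m n : ℕ) (s t : Bool) : (2 * m + bif s then 1 else 0) ^^^ (2 * n + bif t then 1 else 0) =
    2 * (m ^^^ n) + bif (s ^^ t) then 1 else 0 := by
  apply Nat.eq_of_testBit_eq; intro i
  cases i with
  | zero => simp only [Nat.testBit_xor, pack_testBit_zero]
  | succ i => simp only [Nat.testBit_xor, pack_testBit_succ]

/-- The packed defect-bit vector is XOR-linear in the pair. [folklore] -/
theorem foldr_bits_lin {σ : Type} (g : σ → ℕ → Bool) (hg : ∀ s x y, g s (x ^^^ y) = (g s x ^^ g s y)) :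
    ∀ L : List σ, IsLin (fun z => L.foldr (fun s acc => 2 * acc + bif g s z then 1 else 0) 0)
  | [] => fun _ _ => by simp
  | s :: L => by
      intro x y
      have ih := foldr_bits_lin g hg L x y
      dsimp only at ih
      simp only [List.foldr_cons]
      rw [ih, hg, ← pack_xor]

/-- The packed defect-bit vector of a list of `false`s is `0`. [folklore] -/
theorem foldr_bits_zero {σ : Type} (g : σ → ℕ → Bool) {z : ℕ} :
    ∀ L : List σ, (∀ s ∈ L, g s z = false) → L.foldr (fun s acc => 2 * acc + bif g s z then 1 else 0) 0 = 0
  | [], _ => rfl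
  | s :: L, h => by
      simp only [List.foldr_cons]
      rw [foldr_bits_zero g L (fun s' hs' => h s' (List.mem_cons_of_mem _ hs')), h s (List.mem_cons_self ..)]
      rfl

/-- The selected-syndrome map `synBits j` is XOR-linear. [folklore] -/
theorem synBits_lin (j : ℕ) : IsLin (synBits j) := by
  intro x y
  unfold synBits
  exact foldr_bits_lin (fun (s : ℕ × ℕ × ℕ) z => (red (VB j) (defect z s.1 s.2.1)).testBit s.2.2)
    (by intro s x y
        show (red (VB j) (defect (x ^^^ y) s.1 s.2.1)).testBit s.2.2 = _
        rw [show defect (x ^^^ y) s.1 s.2.1 = defect x s.1 s.2.1 ^^^ defect y s.1 s.2.1 from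
          defect_lin s.1 s.2.1 x y, red_lin, Nat.testBit_xor]) (SEL j) x y

/-- MEANING of the `SEL` range check: selected defect coordinates are genuine (generator, element, bit) triples. [folklore] -/
theorem SEL_bound (j : ℕ) (hj : j < 8) : ∀ s ∈ SEL j, s.1 < 2 ∧ s.2.1 < 120 := by
  rcases lt_eight hj with rfl | rfl | rfl | rfl | rfl | rfl | rfl | rfl <;> decide

/-- A cocycle pair has zero selected syndrome. [folklore] -/
theorem synBits_eq_zero {j : ℕ} (hj : j < 8) {z : ℕ} (hz : IsCocyclePair j z) : synBits j z = 0 := by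
  unfold synBits
  apply foldr_bits_zero (fun (s : ℕ × ℕ × ℕ) z => (red (VB j) (defect z s.1 s.2.1)).testBit s.2.2)
  intro s hs
  obtain ⟨h1, h2⟩ := SEL_bound j hj s hs
  show (red (VB j) (defect z s.1 s.2.1)).testBit s.2.2 = false
  rw [hz.2 s.1 h1 s.2.1 h2, Nat.zero_testBit]

/-- MEANING (cocycles, Part I §F): for every `j < 8` and EVERY pair code `z`, `z` is a cocycle datum
modulo `VB j` iff `z` reduces to `0` modulo `SOLB j`, iff `z ∈ span(SOLB j)`. Hence
`#Sol(VB j) = 2^|SOLB j| = 2^(2·dim V + (11,10,7,5,6,4,1,0)_j)`. [folklore] -/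
theorem isCocyclePair_iff (j : ℕ) (hj : j < 8) (z : ℕ) : IsCocyclePair j z ↔ red (SOLB j) z = 0 := by
  have hBred : ∀ v ∈ vecs (SOLB j), red (SOLB j) v = 0 := fun v hv => by
    have := List.all_eq_true.mp (check_sol j hj).2 v hv; simpa using this
  constructor
  · intro hz
    apply red_eq_zero_of_inSpan hBred
    obtain ⟨hc1, hc2, hc3, hc4⟩ := check_cmp j hj
    have hunits : ∀ u ∈ vecs units2, InSpan (vecs (SOLB j ++ CMPB j)) u := fun u hu =>
      inSpan_of_red_eq_zero (by have := List.all_eq_true.mp hc2 u hu; simpa using this)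
    have hx : InSpan (vecs (SOLB j) ++ vecs (CMPB j)) z := by
      rw [← vecs_append]; exact InSpan.mono hunits (inSpan_of_red_eq_zero hz.1)
    refine inSpan_of_syndrome (synBits_lin j) (fun v hv => synBits_eq_zero hj (SOLB_isCocyclePair hj hv))
      ?_ hx (synBits_eq_zero hj hz)
    intro t ht ht0
    rw [(synBits_lin j).map_comb, hc3]
    have hlen : (SYNPAT j).length = (vecs (CMPB j)).length := by rw [← hc3, List.length_map]
    exact hc4 t (hlen ▸ ht) ht0
  · intro hz
    obtain ⟨t, rfl⟩ := inSpan_of_red_eq_zero hz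
    refine ⟨(red_lin units2).comb_eq_zero (fun v hv => (SOLB_isCocyclePair hj hv).1) t, fun a ha k hk => ?_⟩
    exact ((red_lin (VB j)).comp (defect_lin a k)).comb_eq_zero
      (fun v hv => (SOLB_isCocyclePair hj hv).2 a ha k hk) t

/-- `IsCocyclePair j z ↔ z ∈ span(SOLB j)`. [folklore] -/
theorem isCocyclePair_iff_inSpan (j : ℕ) (hj : j < 8) (z : ℕ) : IsCocyclePair j z ↔ InSpan (vecs (SOLB j)) z := by
  rw [isCocyclePair_iff j hj, red_eq_zero_iff]
  intro v hv; have := List.all_eq_true.mp (check_sol j hj).2 v hv; simpa using this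

/-- The dimensions `|SOLB j| = 2·dim(VB j) + (11,10,7,5,6,4,1,0)_j`. [folklore] -/
theorem SOLB_length : (List.range 8).map (fun j => (SOLB j).length) = [11, 12, 15, 15, 16, 16, 19, 20] := by
  decide

/-! ### II.9 MEANING of the quotient certificates: the classes of extension groups -/

/-- Dispatcher: `check_Q_j` for a variable `j < 8`. [folklore] -/
theorem check_Q (j : ℕ) (hj : j < 8) :
    quotCert j (vecs sB) (QBS j) (MASKSS j) (REPSS j) (JREPS j) = true ∧
    quotCert j (vecs admB) (QBM j) (MASKSM j) (REPSM j) (JREPM j) = true := by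
  rcases lt_eight hj with rfl | rfl | rfl | rfl | rfl | rfl | rfl | rfl
  exacts [check_Q_0, check_Q_1, check_Q_2, check_Q_3, check_Q_4, check_Q_5, check_Q_6, check_Q_7]

/-- `List.getD` at an in-range index is the element. [folklore] -/
theorem getD_eq_getElem' {l : List ℕ} {i : ℕ} (d : ℕ) (h : i < l.length) : l.getD i d = l[i] := by
  simp [List.getD_eq_getElem?_getD, h]

/-- `List.getD` at an in-range index is a member. [folklore] -/
theorem getD_mem {l : List ℕ} {i : ℕ} (d : ℕ) (h : i < l.length) : l.getD i d ∈ l := by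
  rw [getD_eq_getElem' d h]; exact List.getElem_mem h

/-- List membership as `getD` at some in-range index. [folklore] -/
theorem mem_iff_getD {l : List ℕ} {x : ℕ} : x ∈ l ↔ ∃ i < l.length, l.getD i 0 = x := by
  constructor
  · intro hx
    obtain ⟨i, hi, rfl⟩ := List.mem_iff_getElem.mp hx
    exact ⟨i, hi, getD_eq_getElem' 0 hi⟩
  · rintro ⟨i, hi, rfl⟩; exact getD_mem 0 hi

/-- If `l.getD 0 0 = 0` and `l ≠ []` then `0 ∈ l`. [folklore] -/
theorem zero_mem_of_getD {l : List ℕ} (h : l.getD 0 1 = 0) : 0 ∈ l := by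
  cases l with
  | nil => simp at h
  | cons a l => simp at h; simp [h]

/-- Combinations of vectors each equivalent to a representative are equivalent to a representative, when the
representatives contain `0` and are closed under `+`. [folklore] -/
theorem reps_cover {L reps : List ℕ} {QB : List (ℕ × ℕ)} (h0 : 0 ∈ reps)
    (hcl : ∀ r₁ ∈ reps, ∀ r₂ ∈ reps, r₁ ^^^ r₂ ∈ reps)
    (hL : ∀ v ∈ L, ∃ r ∈ reps, red QB (v ^^^ r) = 0) (t : ℕ) : ∃ r ∈ reps, red QB (comb L t ^^^ r) = 0 := by
  induction L generalizing t with
  | nil => exact ⟨0, h0, by rw [comb_nil, Nat.zero_xor]; exact red_zero _⟩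
  | cons v L ih =>
    obtain ⟨r₂, hr₂, h₂⟩ := ih (fun w hw => hL w (List.mem_cons_of_mem _ hw)) (t >>> 1)
    obtain ⟨r₁, hr₁, h₁⟩ := hL v (List.mem_cons_self ..)
    refine ⟨(bif t.testBit 0 then r₁ else 0) ^^^ r₂, ?_, ?_⟩
    · cases t.testBit 0
      · simpa using hr₂
      · exact hcl r₁ hr₁ r₂ hr₂
    · rw [comb_cons, xor4, red_lin QB, h₂, Nat.xor_zero]
      cases t.testBit 0
      · simpa using red_zero QB
      · exact h₁

/-- WHAT A QUOTIENT CERTIFICATE ESTABLISHES (for any list `ms` of coboundary sources): `span(QB) = Q :=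
V×V + cob(span ms)`-pairs; the representatives are cocycle data, contain `0`, are closed under `+` and pairwise
inequivalent modulo `Q`; EVERY cocycle datum is equivalent modulo `Q` to exactly one representative; the list of
representatives has no repetition. [folklore] -/
theorem quotCert_sound {j : ℕ} (hj : j < 8) {ms : List ℕ} {QB : List (ℕ × ℕ)} {masks reps jrep : List ℕ}
    (h : quotCert j ms QB masks reps jrep = true) :
    (∀ x, InSpan (gensQ ms j) x ↔ red QB x = 0) ∧
    (∀ r ∈ reps, IsCocyclePair j r) ∧ 0 ∈ reps ∧
    (∀ r₁ ∈ reps, ∀ r₂ ∈ reps, r₁ ^^^ r₂ ∈ reps ∧ (r₁ ≠ r₂ → red QB (r₁ ^^^ r₂) ≠ 0)) ∧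
    (∀ z, IsCocyclePair j z → ∃ r ∈ reps, red QB (z ^^^ r) = 0) ∧
    (∀ z, ∀ r₁ ∈ reps, ∀ r₂ ∈ reps, red QB (z ^^^ r₁) = 0 → red QB (z ^^^ r₂) = 0 → r₁ = r₂) ∧
    (∀ a < reps.length, ∀ b < reps.length, reps.getD a 0 = reps.getD b 0 → a = b) := by
  simp only [quotCert, Bool.and_eq_true, List.all_eq_true, beq_iff_eq, List.mem_range,
    decide_eq_true_eq, Bool.or_eq_true, bne_iff_ne, ne_eq, List.elem_iff] at h
  obtain ⟨⟨⟨⟨⟨⟨q1, q2⟩, q3⟩, q4⟩, q0⟩, q5⟩, q6⟩ := h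
  -- (i) span(gensQ) = {x | red QB x = 0}
  have hspan : ∀ x, InSpan (gensQ ms j) x ↔ red QB x = 0 := by
    intro x; constructor
    · rintro ⟨t, rfl⟩; exact (red_lin QB).comb_eq_zero q1 t
    · intro hx
      refine InSpan.mono ?_ (inSpan_of_red_eq_zero hx)
      intro q hq
      obtain ⟨m, hm, rfl⟩ := mem_iff_getD.mp hq
      exact ⟨masks.getD m 0, q2 m (by simpa [vecs] using hm)⟩
  -- (iv) closure and separation
  have hsep : ∀ r₁ ∈ reps, ∀ r₂ ∈ reps, r₁ ^^^ r₂ ∈ reps ∧ (r₁ ≠ r₂ → red QB (r₁ ^^^ r₂) ≠ 0) := by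
    intro r₁ hr₁ r₂ hr₂
    obtain ⟨a, ha, rfl⟩ := mem_iff_getD.mp hr₁
    obtain ⟨b, hb, rfl⟩ := mem_iff_getD.mp hr₂
    obtain ⟨h1, h2⟩ := q5 a ha b hb
    refine ⟨h2, fun hne => ?_⟩
    rcases h1 with rfl | h1
    · exact absurd rfl hne
    · exact h1
  have hQBself : ∀ q ∈ vecs QB, red QB q = 0 := fun q hq => (q3 q hq).2
  refine ⟨hspan, fun r hr => (isCocyclePair_iff j hj r).mpr (q4 r hr).2, zero_mem_of_getD q0, hsep, ?_, ?_, ?_⟩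
  · -- (v) every cocycle datum is equivalent to a representative
    intro z hz
    obtain ⟨t, rfl⟩ := (isCocyclePair_iff_inSpan j hj z).mp hz
    refine reps_cover (zero_mem_of_getD q0) (fun r₁ h₁ r₂ h₂ => (hsep r₁ h₁ r₂ h₂).1) ?_ t
    intro v hv
    obtain ⟨m, hm, rfl⟩ := mem_iff_getD.mp hv
    have hm' : m < (SOLB j).length := by simpa [vecs] using hm
    obtain ⟨hlt, hred⟩ := q6 m hm'
    have hmj : m < jrep.length := by
      by_contra hc
      have : jrep.getD m reps.length = reps.length := by
        simp [List.getD_eq_getElem?_getD, not_lt.mp hc]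
      rw [this] at hlt
      exact lt_irrefl _ hlt
    have hidx : jrep.getD m 0 = jrep.getD m reps.length := by
      rw [getD_eq_getElem' 0 hmj, getD_eq_getElem' reps.length hmj]
    refine ⟨reps.getD (jrep.getD m 0) 0, getD_mem 0 (hidx ▸ hlt), hred⟩
  · -- (vi) uniqueness of the representative
    intro z r₁ hr₁ r₂ hr₂ h₁ h₂
    by_contra hne
    apply (hsep r₁ hr₁ r₂ hr₂).2 hne
    have : r₁ ^^^ r₂ = (z ^^^ r₁) ^^^ (z ^^^ r₂) := by rw [xor4, Nat.xor_self, Nat.zero_xor]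
    rw [this, red_lin QB, h₁, h₂]; rfl
  · -- (vii) no repetition
    intro a ha b hb hab
    obtain ⟨h1, -⟩ := q5 a ha b hb
    rcases h1 with h1 | h1
    · exact h1
    · rw [hab, Nat.xor_self] at h1; exact absurd (red_zero QB) h1

/-- The coboundary map `m ↦ (m + g₀mg₀⁻¹, m + g₁mg₁⁻¹)` is `𝔽₂`-linear. [folklore] -/
theorem cob_lin : IsLin cob := by
  intro x y
  simp only [cob]
  exact ((IsLin.id.xor (conj_lin cG0 cG0i)).xor
    ((IsLin.shiftLeft 16).comp (IsLin.id.xor (conj_lin cG1 cG1i)))) x y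

/-- Two cocycle data `z, z'` modulo `V = span(VB j)` are EQUIVALENT relative to the coboundary sources `ms`
(`ms = sB`: conjugacy of the extension groups inside `𝔰𝔭₄(𝔽₂) ⋊ G`; `ms = admB`: conjugacy inside
`M₄(𝔽₂) ⋊ G`): `z + z' ∈ V × V + {cob m : m ∈ span(ms)}` — changing the values of `c` inside `V` does not change
`E = {(c(g)+v, g)}`, and conjugating `E` by `(m, h)` replaces `c` by `c + cob(c(h)) + cob(m)` with `c(h) ∈ 𝔰`
(so exactly the admissible `m` keep `E` inside `𝔰 ⋊ G`). [cite: BrumerEtAl2019, §5.1 p. 1173] -/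
def CobEquiv (ms : List ℕ) (j z z' : ℕ) : Prop := InSpan (gensQ ms j) (z ^^^ z')

/-- Coboundaries `cob m` of admissible `m` (resp. `m ∈ 𝔰`) are among the generators `gensQ`. [folklore] -/
theorem cob_mem_gensQ {ms : List ℕ} (j : ℕ) {m : ℕ} (hm : InSpan ms m) : InSpan (gensQ ms j) (cob m) := by
  refine InSpan.mono (fun v hv => InSpan.of_mem ?_) (hm.map cob_lin)
  simp only [gensQ, List.mem_append]
  exact Or.inr hv

/-- Pairs of `VB j` vectors are among the generators `gensQ`. [folklore] -/
theorem VBpair_mem_gensQ {ms : List ℕ} {j : ℕ} {v₀ v₁ : ℕ} (h₀ : v₀ ∈ vecs (VB j)) (h₁ : v₁ ∈ vecs (VB j)) :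
    InSpan (gensQ ms j) (v₀ ^^^ (v₁ <<< 16)) := by
  refine InSpan.xor (InSpan.of_mem ?_) (InSpan.of_mem ?_) <;> simp only [gensQ, List.mem_append, List.mem_map]
  · exact Or.inl (Or.inl h₀)
  · exact Or.inl (Or.inr ⟨v₁, h₁, rfl⟩)

/-- THEOREM (BPPTVY Thm 5.3.1, the count `10`, MEANING FORM): for each of the eight `G`-submodules
`V = span(VB j)` of `𝔰`, every cocycle datum modulo `V` — i.e. every extension group `E ≤ 𝔰𝔭₄(𝔽₂) ⋊ G` with
`π(E) = G`, `E ∩ 𝔰 = V` — is `M₄(𝔽₂) ⋊ G`-equivalent to EXACTLY ONE of the tabulated representatives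
`REPSM j`, which are themselves cocycle data, pairwise inequivalent and without repetition; their numbers are
`2,1,2,1,1,1,1,1` (total `10`) with `#V = 2^k`, `k = 0,0,1,4,4,5,5,6,9,10` (`classCount_M`, `kMultiset_M`). [cite: BrumerEtAl2019, Thm 5.3.1 p. 1176] -/
theorem extension_classes_M (j : ℕ) (hj : j < 8) :
    (∀ z, IsCocyclePair j z → ∃! r, r ∈ REPSM j ∧ CobEquiv (vecs admB) j z r) ∧
    (∀ r ∈ REPSM j, IsCocyclePair j r) ∧
    (∀ r₁ ∈ REPSM j, ∀ r₂ ∈ REPSM j, CobEquiv (vecs admB) j r₁ r₂ → r₁ = r₂) ∧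
    (∀ a < (REPSM j).length, ∀ b < (REPSM j).length, (REPSM j).getD a 0 = (REPSM j).getD b 0 → a = b) := by
  obtain ⟨hspan, hreps, -, hsep, hex, huniq, hnodup⟩ := quotCert_sound hj (check_Q j hj).2
  refine ⟨fun z hz => ?_, hreps, fun r₁ h₁ r₂ h₂ he => ?_, hnodup⟩
  · obtain ⟨r, hr, hzr⟩ := hex z hz
    refine ⟨r, ⟨hr, (hspan _).mpr hzr⟩, ?_⟩
    rintro r' ⟨hr', hzr'⟩
    exact huniq z r' hr' r hr ((hspan _).mp hzr') hzr
  · by_contra hne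
    exact (hsep r₁ h₁ r₂ h₂).2 hne ((hspan _).mp he)

/-- THEOREM (BPPTVY Thm 5.3.1, the count `18`, MEANING FORM): the same with conjugacy inside
`𝔰𝔭₄(𝔽₂) ⋊ G` (coboundaries of `m ∈ 𝔰` only): numbers of classes `4,2,4,2,2,1,2,1` (total `18`, `classCount_S`). [cite: BrumerEtAl2019, Thm 5.3.1 p. 1176] -/
theorem extension_classes_S (j : ℕ) (hj : j < 8) :
    (∀ z, IsCocyclePair j z → ∃! r, r ∈ REPSS j ∧ CobEquiv (vecs sB) j z r) ∧
    (∀ r ∈ REPSS j, IsCocyclePair j r) ∧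
    (∀ r₁ ∈ REPSS j, ∀ r₂ ∈ REPSS j, CobEquiv (vecs sB) j r₁ r₂ → r₁ = r₂) ∧
    (∀ a < (REPSS j).length, ∀ b < (REPSS j).length, (REPSS j).getD a 0 = (REPSS j).getD b 0 → a = b) := by
  obtain ⟨hspan, hreps, -, hsep, hex, huniq, hnodup⟩ := quotCert_sound hj (check_Q j hj).1
  refine ⟨fun z hz => ?_, hreps, fun r₁ h₁ r₂ h₂ he => ?_, hnodup⟩
  · obtain ⟨r, hr, hzr⟩ := hex z hz
    refine ⟨r, ⟨hr, (hspan _).mpr hzr⟩, ?_⟩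
    rintro r' ⟨hr', hzr'⟩
    exact huniq z r' hr' r hr ((hspan _).mp hzr') hzr
  · by_contra hne
    exact (hsep r₁ h₁ r₂ h₂).2 hne ((hspan _).mp he)

/-- The totals: `18` classes in `𝔰𝔭₄(𝔽₂) ⋊ G`, `10` in `M₄(𝔽₂) ⋊ G`. [cite: BrumerEtAl2019, Thm 5.3.1 p. 1176] -/
theorem total_classes : ((List.range 8).map fun j => (REPSS j).length).sum = 18 ∧
    ((List.range 8).map fun j => (REPSM j).length).sum = 10 := by
  constructor <;> decide

/-! ### II.10 Matrix algebra of the bit model: associativity and units, by (tri)linearity from the basis -/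

set_option maxRecDepth 200000 in
/-- KERNEL CHECK: associativity of `mmul` on the `4096` triples of unit vectors, and the unit laws on the
`16` unit vectors. [folklore] -/
theorem check_basis : ((List.range 16).all fun i => (List.range 16).all fun j => (List.range 16).all fun k =>
      mmul (mmul (2 ^ i) (2 ^ j)) (2 ^ k) == mmul (2 ^ i) (mmul (2 ^ j) (2 ^ k))) = true ∧
    ((List.range 16).all fun i => mmul (2 ^ i) cI == 2 ^ i && mmul cI (2 ^ i) == 2 ^ i) = true ∧
    (mmul cG0 cG0i == cI && mmul cG0i cG0 == cI && mmul cG1 cG1i == cI && mmul cG1i cG1 == cI) = true := by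
  refine ⟨?_, ?_, ?_⟩ <;> decide +kernel

/-- Two linear maps agreeing on the unit vectors `2^i`, `i < n`, agree on all `x < 2ⁿ`. [folklore] -/
theorem eq_on_lt_two_pow {f g : ℕ → ℕ} (hf : IsLin f) (hg : IsLin g) {n : ℕ} (h : ∀ i < n, f (2 ^ i) = g (2 ^ i))
    {x : ℕ} (hx : x < 2 ^ n) : f x = g x := by
  have hL : ∀ i < n, InSpan ((List.range n).map (2 ^ ·)) (2 ^ i) := fun i hi =>
    InSpan.of_mem (List.mem_map.mpr ⟨i, List.mem_range.mpr hi, rfl⟩)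
  obtain ⟨t, rfl⟩ := inSpan_of_lt_two_pow hL hx
  rw [hf.map_comb, hg.map_comb]
  congr 1
  apply List.map_congr_left
  intro v hv
  obtain ⟨i, hi, rfl⟩ := List.mem_map.mp hv
  exact h i (List.mem_range.mp hi)

/-- Associativity of the bit-matrix product on codes `< 2¹⁶` (from the `4096` basis instances by trilinearity). [folklore] -/
theorem mmul_assoc {a b c : ℕ} (ha : a < 65536) (hb : b < 65536) (hc : c < 65536) :
    mmul (mmul a b) c = mmul a (mmul b c) := by
  rw [show (65536 : ℕ) = 2 ^ 16 by norm_num] at ha hb hc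
  have hbasis : ∀ i < 16, ∀ j < 16, ∀ k < 16,
      mmul (mmul (2 ^ i) (2 ^ j)) (2 ^ k) = mmul (2 ^ i) (mmul (2 ^ j) (2 ^ k)) := by
    intro i hi j hj k hk
    have := List.all_eq_true.mp (List.all_eq_true.mp (List.all_eq_true.mp check_basis.1 i
      (List.mem_range.mpr hi)) j (List.mem_range.mpr hj)) k (List.mem_range.mpr hk)
    exact beq_iff_eq.mp this
  refine eq_on_lt_two_pow (f := fun a => mmul (mmul a b) c) (g := fun a => mmul a (mmul b c))
    ((mmul_lin_left c).comp (mmul_lin_left b)) (mmul_lin_left _) (fun i hi => ?_) ha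
  refine eq_on_lt_two_pow (f := fun b => mmul (mmul (2 ^ i) b) c) (g := fun b => mmul (2 ^ i) (mmul b c))
    ((mmul_lin_left c).comp (mmul_lin_right _)) ((mmul_lin_right _).comp (mmul_lin_left c)) (fun j hj => ?_) hb
  exact eq_on_lt_two_pow (f := fun c => mmul (mmul (2 ^ i) (2 ^ j)) c)
    (g := fun c => mmul (2 ^ i) (mmul (2 ^ j) c))
    (mmul_lin_right _) ((mmul_lin_right _).comp (mmul_lin_right _)) (fun k hk => hbasis i hi j hj k hk) hc

/-- `a · 1 = a` for codes `< 2¹⁶`. [folklore] -/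
theorem mmul_cI_right {a : ℕ} (ha : a < 65536) : mmul a cI = a := by
  rw [show (65536 : ℕ) = 2 ^ 16 by norm_num] at ha
  refine eq_on_lt_two_pow (f := fun a => mmul a cI) (g := fun a => a) (mmul_lin_left cI) IsLin.id
    (fun i hi => ?_) ha
  have := List.all_eq_true.mp check_basis.2.1 i (List.mem_range.mpr hi)
  simp only [Bool.and_eq_true, beq_iff_eq] at this
  exact this.1

/-- `1 · a = a` for codes `< 2¹⁶`. [folklore] -/
theorem mmul_cI_left {a : ℕ} (ha : a < 65536) : mmul cI a = a := by
  rw [show (65536 : ℕ) = 2 ^ 16 by norm_num] at ha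
  refine eq_on_lt_two_pow (f := fun a => mmul cI a) (g := fun a => a) (mmul_lin_right cI) IsLin.id
    (fun i hi => ?_) ha
  have := List.all_eq_true.mp check_basis.2.1 i (List.mem_range.mpr hi)
  simp only [Bool.and_eq_true, beq_iff_eq] at this
  exact this.2

/-- Two-sided inverses are unique (in the monoid of `4 × 4` bit matrices). [folklore] -/
theorem inv_unique {g u v : ℕ} (hg : g < 65536) (hu : u < 65536) (hv : v < 65536)
    (hug : mmul u g = cI) (hgv : mmul g v = cI) : u = v := by
  calc u = mmul u cI := (mmul_cI_right hu).symm
    _ = mmul u (mmul g v) := by rw [hgv]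
    _ = mmul (mmul u g) v := (mmul_assoc hu hg hv).symm
    _ = v := by rw [hug, mmul_cI_left hv]

/-- `cI < 2¹⁶`. [folklore] -/
theorem cI_lt : cI < 65536 := by decide

/-- Generator codes are `< 2¹⁶`. [folklore] -/
theorem gN_lt (a : ℕ) : gN a < 65536 := by unfold gN; cases (a == 0) <;> decide
/-- Inverse-generator codes are `< 2¹⁶`. [folklore] -/
theorem giN_lt (a : ℕ) : giN a < 65536 := by unfold giN; cases (a == 0) <;> decide

/-- `g_a · g_a⁻¹ = 1 = g_a⁻¹ · g_a` for the two generators. [folklore] -/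
theorem gN_mul_giN (a : ℕ) : mmul (gN a) (giN a) = cI ∧ mmul (giN a) (gN a) = cI := by
  have h := check_basis.2.2
  simp only [Bool.and_eq_true, beq_iff_eq] at h
  unfold gN giN
  cases (a == 0)
  · exact ⟨h.1.2, h.2⟩
  · exact ⟨h.1.1.1, h.1.1.2⟩

/-- The product of the INVERSE generators along a word, reversed: the inverse of `evalC w`. [folklore] -/
def evalCi : List (Fin 2) → ℕ
  | [] => cI
  | a :: w => mmul (evalCi w) (giN a.val)

/-- `evalC w < 2¹⁶`. [folklore] -/
theorem evalC_lt : ∀ w, evalC w < 65536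
  | [] => cI_lt
  | _ :: _ => mmul_lt _ _

/-- `evalCi w < 2¹⁶`. [folklore] -/
theorem evalCi_lt : ∀ w, evalCi w < 65536
  | [] => cI_lt
  | _ :: _ => mmul_lt _ _

/-- `evalC w · evalCi w = 1`. [folklore] -/
theorem evalC_mul_evalCi : ∀ w, mmul (evalC w) (evalCi w) = cI
  | [] => mmul_cI_left cI_lt
  | a :: w => by
      show mmul (mmul (gN a.val) (evalC w)) (mmul (evalCi w) (giN a.val)) = cI
      rw [mmul_assoc (gN_lt _) (evalC_lt _) (mmul_lt _ _), ← mmul_assoc (evalC_lt _) (evalCi_lt _) (giN_lt _),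
        evalC_mul_evalCi w, mmul_cI_left (giN_lt _), (gN_mul_giN _).1]

/-- `evalCi w · evalC w = 1`. [folklore] -/
theorem evalCi_mul_evalC : ∀ w, mmul (evalCi w) (evalC w) = cI
  | [] => mmul_cI_left cI_lt
  | a :: w => by
      show mmul (mmul (evalCi w) (giN a.val)) (mmul (gN a.val) (evalC w)) = cI
      rw [mmul_assoc (evalCi_lt _) (giN_lt _) (mmul_lt _ _), ← mmul_assoc (giN_lt _) (gN_lt _) (evalC_lt _),
        (gN_mul_giN _).2, mmul_cI_left (evalC_lt _), evalCi_mul_evalC w]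

/-- Conjugation is an action: `(gh) x (h⁻¹g⁻¹) = g (h x h⁻¹) g⁻¹`. [folklore] -/
theorem conj_mmul {g h gi hi x : ℕ} (hg : g < 65536) (hh : h < 65536) (hgi : gi < 65536) (hhi : hi < 65536)
    (hx : x < 65536) : conj (mmul g h) (mmul hi gi) x = conj g gi (conj h hi x) := by
  simp only [conj]
  rw [← mmul_assoc (mmul_lt _ _) hhi hgi, mmul_assoc hg hh hx, mmul_assoc hg (mmul_lt _ _) hhi]

/-- Conjugation by `1` is the identity on codes `< 2¹⁶`. [folklore] -/
theorem conj_cI {x : ℕ} (hx : x < 65536) : conj cI cI x = x := by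
  simp only [conj]; rw [mmul_cI_left hx, mmul_cI_right hx]

/-- A set of codes closed under conjugation by the two generators of `G` is closed under conjugation by every
word in them (i.e. by all of `G`). [folklore] -/
theorem conj_word_mem {S : Set ℕ} (hS : ∀ x ∈ S, x < 65536) (h0 : ∀ x ∈ S, conj cG0 cG0i x ∈ S)
    (h1 : ∀ x ∈ S, conj cG1 cG1i x ∈ S) :
    ∀ (w : List (Fin 2)) (x : ℕ), x ∈ S → conj (evalC w) (evalCi w) x ∈ S
  | [], x, hx => by
      show conj cI cI x ∈ S
      rw [conj_cI (hS x hx)]; exact hx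
  | a :: w, x, hx => by
      show conj (mmul (gN a.val) (evalC w)) (mmul (evalCi w) (giN a.val)) x ∈ S
      rw [conj_mmul (gN_lt _) (evalC_lt _) (giN_lt _) (evalCi_lt _) (hS x hx)]
      have ih := conj_word_mem hS h0 h1 w x hx
      rcases Fin.exists_fin_two.mp ⟨a, rfl⟩ with ha | ha
      · subst ha; exact h0 _ ih
      · subst ha; exact h1 _ ih

/-! #### The element tables as words -/

set_option maxRecDepth 200000 in
/-- KERNEL CHECK: all tabulated codes are `< 2¹⁶`, the inverse list is a sublist of the element list (as a
set), both have length `120`, `el 0 = eli 0 = 1`, and the conjugating indices `gT t` are `< 120`. [folklore] -/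
theorem check_tables : (EL.all fun e => decide (e < 65536)) = true ∧ (ELinv.all fun e => decide (e < 65536)) = true ∧
    (ELinv.all fun e => EL.elem e) = true ∧ EL.length = 120 ∧ ELinv.length = 120 ∧ el 0 = cI ∧ eli 0 = cI ∧
    ((List.range 1024).all fun t => decide (gT t < 120)) = true := by
  refine ⟨?_, ?_, ?_, ?_, ?_, ?_, ?_, ?_⟩ <;> decide +kernel

/-- A `getD` into a list of numbers `< N` is `< N` (`0 < N`). [folklore] -/
theorem getD_lt {l : List ℕ} {N : ℕ} (h : (l.all fun e => decide (e < N)) = true) (hN : 0 < N) (k : ℕ) :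
    l.getD k 0 < N := by
  rcases lt_or_ge k l.length with hk | hk
  · have := List.all_eq_true.mp h _ (getD_mem 0 hk); simpa using this
  · simpa [List.getD_eq_getElem?_getD, List.getElem?_eq_none hk] using hN

/-- `el k < 2¹⁶`. [folklore] -/
theorem el_lt (k : ℕ) : el k < 65536 := getD_lt check_tables.1 (by norm_num) k
/-- `eli k < 2¹⁶`. [folklore] -/
theorem eli_lt (k : ℕ) : eli k < 65536 := getD_lt check_tables.2.1 (by norm_num) k

/-- `el k` is the value of the `k`-th normal-form word (`k < 120`). [folklore] -/
theorem el_eq (k : ℕ) (hk : k < 120) : el k = evalC (wordAt k) := (EL_facts k hk).1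

/-- `eli k` is the word-inverse of the `k`-th normal-form word (`k < 120`). [folklore] -/
theorem eli_eq (k : ℕ) (hk : k < 120) : eli k = evalCi (wordAt k) := by
  obtain ⟨h1, -, h3, -⟩ := EL_facts k hk
  exact inv_unique (el_lt k) (eli_lt k) (evalCi_lt _) h3 (by rw [h1]; exact evalC_mul_evalCi _)

/-- Every inverse is itself a tabulated element: `eli k = el k'`, and then `el k` is the word-inverse of `k'`. [folklore] -/
theorem eli_as_word (k : ℕ) (hk : k < 120) : ∃ k' < 120, eli k = evalC (wordAt k') ∧ el k = evalCi (wordAt k') := by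
  have hmem : eli k ∈ ELinv := getD_mem 0 (by rw [check_tables.2.2.2.2.1]; exact hk)
  have hEL : eli k ∈ EL := by
    have := List.all_eq_true.mp check_tables.2.2.1 _ hmem; simpa using this
  obtain ⟨k', hk', hkk'⟩ := mem_iff_getD.mp hEL
  rw [check_tables.2.2.2.1] at hk'
  have he : eli k = el k' := hkk'.symm
  refine ⟨k', hk', by rw [he, el_eq k' hk'], ?_⟩
  obtain ⟨-, h2, -, -⟩ := EL_facts k hk
  have h2' : mmul (el k) (el k') = cI := by rw [← he]; exact h2
  exact inv_unique (el_lt k') (el_lt k) (evalCi_lt _) h2' (by rw [el_eq k' hk']; exact evalC_mul_evalCi _)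

/-- A set of codes (`< 2¹⁶`) closed under conjugation by the generators is closed under `x ↦ e_k x e_k⁻¹` and
`x ↦ e_k⁻¹ x e_k` for all `120` elements. [folklore] -/
theorem conj_el_mem {S : Set ℕ} (hS : ∀ x ∈ S, x < 65536) (h0 : ∀ x ∈ S, conj cG0 cG0i x ∈ S)
    (h1 : ∀ x ∈ S, conj cG1 cG1i x ∈ S) (k : ℕ) (hk : k < 120) (x : ℕ) (hx : x ∈ S) :
    conj (el k) (eli k) x ∈ S ∧ conj (eli k) (el k) x ∈ S := by
  constructor
  · rw [el_eq k hk, eli_eq k hk]; exact conj_word_mem hS h0 h1 _ x hx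
  · obtain ⟨k', -, h1', h2'⟩ := eli_as_word k hk
    rw [h1', h2']; exact conj_word_mem hS h0 h1 _ x hx

/-- `e_k⁻¹ (e_k x e_k⁻¹) e_k = x`. [folklore] -/
theorem conj_inv_cancel {k x : ℕ} (hk : k < 120) (hx : x < 65536) : conj (eli k) (el k) (conj (el k) (eli k) x) = x := by
  obtain ⟨-, -, h3, -⟩ := EL_facts k hk
  rw [← conj_mmul (eli_lt k) (el_lt k) (el_lt k) (eli_lt k) hx, h3, conj_cI hx]

/-! ### II.11 Soundness of echelon insertion, and the MEANING of the submodule-lattice certificates -/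

/-- A XOR-closed set containing `0` and every vector of `L` contains every combination `comb L t`. [folklore] -/
theorem comb_mem_closed {T : Set ℕ} (hTx : ∀ a ∈ T, ∀ b ∈ T, a ^^^ b ∈ T) (hT0 : (0 : ℕ) ∈ T) {L : List ℕ}
    (hL : ∀ v ∈ L, v ∈ T) (t : ℕ) : comb L t ∈ T := by
  induction L generalizing t with
  | nil => exact hT0
  | cons v L ih =>
    rw [comb_cons]
    refine hTx _ ?_ _ (ih (fun w hw => hL w (List.mem_cons_of_mem _ hw)) _)
    cases t.testBit 0
    · exact hT0
    · exact hL v (List.mem_cons_self ..)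

/-- A XOR-closed set containing `0` and the list `L` contains `span L`. [folklore] -/
theorem mem_of_inSpan_closed {T : Set ℕ} (hTx : ∀ a ∈ T, ∀ b ∈ T, a ^^^ b ∈ T) (hT0 : (0 : ℕ) ∈ T) {L : List ℕ}
    (hL : ∀ v ∈ L, v ∈ T) {x : ℕ} (hx : InSpan L x) : x ∈ T := by
  obtain ⟨t, rfl⟩ := hx; exact comb_mem_closed hTx hT0 hL t

/-- `x ⊕ (x ⊕ r) = r`. [folklore] -/
theorem xor_xor_cancel_left (x r : ℕ) : x ^^^ (x ^^^ r) = r := by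
  rw [← Nat.xor_assoc, Nat.xor_self, Nat.zero_xor]

/-- Insertion keeps the basis inside any subspace containing the old basis and the inserted vector. [folklore] -/
theorem ins_sub {T : Set ℕ} (hTx : ∀ a ∈ T, ∀ b ∈ T, a ^^^ b ∈ T) (hT0 : (0 : ℕ) ∈ T) {B : List (ℕ × ℕ)}
    (hB : ∀ b ∈ vecs B, b ∈ T) {x : ℕ} (hx : x ∈ T) : ∀ b ∈ vecs (ins B x), b ∈ T := by
  have hr : red B x ∈ T := by
    rw [← xor_xor_cancel_left x (red B x)]
    exact hTx _ hx _ (mem_of_inSpan_closed hTx hT0 hB (inSpan_xor_red B x))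
  unfold ins; dsimp only
  cases (red B x == 0)
  · intro b hb
    simp only [cond_false, vecs, List.map_append, List.map_cons, List.map_nil, List.mem_append,
      List.mem_singleton] at hb
    rcases hb with hb | rfl
    · exact hB b hb
    · exact hr
  · simpa using hB

/-- Insertion only grows the span. [folklore] -/
theorem ins_mono {B : List (ℕ × ℕ)} {x y : ℕ} (h : InSpan (vecs B) y) : InSpan (vecs (ins B x)) y := by
  unfold ins; dsimp only
  cases (red B x == 0)
  · refine InSpan.mono (fun v hv => InSpan.of_mem ?_) h
    simp only [cond_false, vecs, List.map_append, List.mem_append]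
    exact Or.inl hv
  · simpa using h

/-- The inserted vector lies in the span of the new basis. [folklore] -/
theorem ins_mem (B : List (ℕ × ℕ)) (x : ℕ) : InSpan (vecs (ins B x)) x := by
  by_cases h : red B x = 0
  · have : InSpan (vecs B) x := inSpan_of_red_eq_zero h
    unfold ins; dsimp only
    simpa [h] using this
  · have hb : (red B x == 0) = false := by simp [h]
    unfold ins; dsimp only
    rw [hb, cond_false]
    have h1 : InSpan (vecs (B ++ [(Nat.log2 (red B x), red B x)])) (x ^^^ red B x) :=
      InSpan.mono (fun v hv => InSpan.of_mem (by simp [vecs] at hv ⊢; exact Or.inl hv)) (inSpan_xor_red B x)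
    have h2 : InSpan (vecs (B ++ [(Nat.log2 (red B x), red B x)])) (red B x) :=
      InSpan.of_mem (by simp [vecs])
    have := h1.xor h2
    rwa [Nat.xor_assoc, Nat.xor_self, Nat.xor_zero] at this

/-- Folding echelon insertions keeps all basis vectors inside any subspace containing the start basis and the inserted vectors. [folklore] -/
theorem foldIns_sub {α : Type} (y : α → ℕ) {T : Set ℕ} (hTx : ∀ a ∈ T, ∀ b ∈ T, a ^^^ b ∈ T) (hT0 : (0 : ℕ) ∈ T) :
    ∀ (ks : List α) (B : List (ℕ × ℕ)), (∀ b ∈ vecs B, b ∈ T) → (∀ k ∈ ks, y k ∈ T) →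
      ∀ b ∈ vecs (ks.foldl (fun B k => ins B (y k)) B), b ∈ T
  | [], _, hB, _ => hB
  | k :: ks, B, hB, hy =>
      foldIns_sub y hTx hT0 ks (ins B (y k)) (ins_sub hTx hT0 hB (hy k (List.mem_cons_self ..)))
        (fun k' hk' => hy k' (List.mem_cons_of_mem _ hk'))

/-- Folding echelon insertions only grows the span. [folklore] -/
theorem foldIns_mono {α : Type} (y : α → ℕ) : ∀ (ks : List α) (B : List (ℕ × ℕ)) {x : ℕ},
    InSpan (vecs B) x → InSpan (vecs (ks.foldl (fun B k => ins B (y k)) B)) x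
  | [], _, _, h => h
  | _ :: ks, _, _, h => foldIns_mono y ks _ (ins_mono h)

/-- Every inserted vector lies in the span of the folded echelon basis. [folklore] -/
theorem foldIns_mem {α : Type} (y : α → ℕ) : ∀ (ks : List α) (B : List (ℕ × ℕ)) {k : α}, k ∈ ks →
    InSpan (vecs (ks.foldl (fun B k => ins B (y k)) B)) (y k)
  | [], _, _, h => absurd h (List.not_mem_nil)
  | k' :: ks, B, k, h => by
      rcases List.mem_cons.mp h with rfl | h
      · exact foldIns_mono y ks _ (ins_mem B (y k))
      · exact foldIns_mem y ks _ h

/-- SOUNDNESS of `spanEq`: mutual reduction to `0` gives mutual containment of spans. [folklore] -/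
theorem spanEq_sound {B₁ B₂ : List (ℕ × ℕ)} (h : spanEq B₁ B₂ = true) :
    (∀ v ∈ vecs B₂, InSpan (vecs B₁) v) ∧ (∀ v ∈ vecs B₁, InSpan (vecs B₂) v) := by
  simp only [spanEq, allRed, Bool.and_eq_true, List.all_eq_true, beq_iff_eq] at h
  exact ⟨fun v hv => inSpan_of_red_eq_zero (h.1 v hv), fun v hv => inSpan_of_red_eq_zero (h.2 v hv)⟩

/-- MEANING of `check_sum`: `span(VB i) + span(VB j) = span(VB (sumIdx i j))`. [folklore] -/
theorem sum_facts (i : ℕ) (hi : i < 8) (j : ℕ) (hj : j < 8) : sumIdx i j < 8 ∧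
    (∀ b ∈ vecs (VB i) ++ vecs (VB j), InSpan (vecs (VB (sumIdx i j))) b) ∧
    (∀ b ∈ vecs (VB (sumIdx i j)), InSpan (vecs (VB i) ++ vecs (VB j)) b) := by
  have h := List.all_eq_true.mp (List.all_eq_true.mp check_sum i (List.mem_range.mpr hi)) j (List.mem_range.mpr hj)
  simp only [Bool.and_eq_true, decide_eq_true_eq] at h
  obtain ⟨h8, hsp⟩ := h
  obtain ⟨hA, hB⟩ := spanEq_sound hsp
  have hech : echelon (vecs (VB i) ++ vecs (VB j)) =
      (vecs (VB i) ++ vecs (VB j)).foldl (fun B k => ins B ((fun v => v) k)) [] := rfl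
  refine ⟨h8, fun b hb => ?_, fun b hb => ?_⟩
  · refine InSpan.mono hB ?_
    rw [hech]; exact foldIns_mem (fun v => v) _ [] hb
  · refine InSpan.mono ?_ (hA b hb)
    rw [hech]
    refine foldIns_sub (fun v => v) (T := {z | InSpan (vecs (VB i) ++ vecs (VB j)) z})
      (fun a ha b hb => InSpan.xor ha hb) (InSpan.zero _) _ [] (by simp [vecs]) ?_
    intro k hk; exact InSpan.of_mem hk

/-- MEANING of `check_orbitRep` for one `t < 1024`. [folklore] -/
theorem orbitRep_facts (t : ℕ) (ht : t < 1024) :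
    red sB (conj (el (gT t)) (eli (gT t)) (sElt t)) = 0 ∧
    ∃ r ∈ REPS, sElt r = conj (el (gT t)) (eli (gT t)) (sElt t) ∧ cycIdx r = cycIdx t := by
  have h := List.all_eq_true.mp (List.all_eq_true.mp check_orbitRep (t / 256) (List.mem_range.mpr (by omega)))
    (t % 256) (List.mem_range.mpr (Nat.mod_lt _ (by norm_num)))
  have ht' : 256 * (t / 256) + t % 256 = t := Nat.div_add_mod t 256
  simp only [ht', Bool.and_eq_true, beq_iff_eq, List.elem_iff] at h
  exact ⟨h.1.1.1, _, h.1.1.2, h.1.2, h.2⟩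

/-- The conjugating indices `gT t` are `< 120`. [folklore] -/
theorem gT_lt (t : ℕ) (ht : t < 1024) : gT t < 120 := by
  have := List.all_eq_true.mp check_tables.2.2.2.2.2.2.2 t (List.mem_range.mpr ht); simpa using this

/-- `cycIdx t < 8`. [folklore] -/
theorem cycIdx_lt (t : ℕ) : cycIdx t < 8 := Nat.mod_lt _ (by norm_num)

/-- The span of `VB c` as a set: a subspace of `𝔰`, of codes `< 2¹⁶`, stable under all conjugations. [folklore] -/
theorem VBspan_closed (c : ℕ) (hc : c < 8) :
    (∀ a ∈ {z | red (VB c) z = 0}, ∀ b ∈ {z | red (VB c) z = 0}, a ^^^ b ∈ {z | red (VB c) z = 0}) ∧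
    ((0 : ℕ) ∈ {z | red (VB c) z = 0}) ∧ (∀ x ∈ {z | red (VB c) z = 0}, x < 65536) ∧
    (∀ x ∈ {z | red (VB c) z = 0}, conj cG0 cG0i x ∈ {z | red (VB c) z = 0}) ∧
    (∀ x ∈ {z | red (VB c) z = 0}, conj cG1 cG1i x ∈ {z | red (VB c) z = 0}) := by
  simp only [Set.mem_setOf_eq]
  refine ⟨fun a ha b hb => red_xor_eq_zero ha hb, red_zero _, fun x hx => ?_,
    fun x hx => VB_conj_closed c hc hx 0, fun x hx => VB_conj_closed c hc hx 1⟩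
  obtain ⟨t, rfl⟩ := inSpan_of_red_eq_zero hx
  exact lt_of_red_sB ((red_lin sB).comb_eq_zero (fun v hv => (VB_facts c hc v hv).1) t)

/-- THE CYCLIC SUBMODULE LEMMA: for every `x` in a `G`-submodule `S ⊆ 𝔰` there is a tabulated `VB c` with
`x ∈ span(VB c) ⊆ S` (namely the span of the `G`-orbit of `x`). [folklore] -/
theorem cyclic_submodule {S : Set ℕ} (h𝔰 : ∀ x ∈ S, red sB x = 0) (h0 : (0 : ℕ) ∈ S)
    (hadd : ∀ x ∈ S, ∀ y ∈ S, x ^^^ y ∈ S) (hg0 : ∀ x ∈ S, conj cG0 cG0i x ∈ S)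
    (hg1 : ∀ x ∈ S, conj cG1 cG1i x ∈ S) {x : ℕ} (hx : x ∈ S) :
    ∃ c < 8, (∀ b ∈ vecs (VB c), b ∈ S) ∧ InSpan (vecs (VB c)) x := by
  have hS : ∀ x ∈ S, x < 65536 := fun x hx => lt_of_red_sB (h𝔰 x hx)
  -- x = sElt t with t < 1024
  obtain ⟨t₀, ht₀⟩ := inSpan_of_red_eq_zero (h𝔰 x hx)
  set t := t₀ % 2 ^ 10 with ht_def
  have ht : t < 1024 := Nat.mod_lt _ (by norm_num)
  have hxt : sElt t = x := by rw [← ht₀]; exact comb_mod (vecs sB) t₀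
  -- the conjugate y and its representative
  obtain ⟨hy𝔰, r, hr, hry, hcyc⟩ := orbitRep_facts t ht
  have hg := gT_lt t ht
  set y := conj (el (gT t)) (eli (gT t)) (sElt t) with hy_def
  have hyS : y ∈ S := (conj_el_mem hS hg0 hg1 _ hg _ (hxt.symm ▸ hx)).1
  set c := cycIdx r with hc_def
  have hc : c < 8 := cycIdx_lt r
  obtain ⟨hA, hB⟩ := spanEq_sound (List.all_eq_true.mp check_cyc r hr)
  rw [hry] at hA hB
  -- the orbit echelon basis lies in S
  have horb : orbitEch y = (List.range 120).foldl (fun B k => ins B ((fun k => conj (el k) (eli k) y) k)) [] := rfl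
  have hEchS : ∀ b ∈ vecs (orbitEch y), b ∈ S := by
    rw [horb]
    refine foldIns_sub _ hadd h0 _ [] (by simp [vecs]) ?_
    intro k hk
    exact (conj_el_mem hS hg0 hg1 k (List.mem_range.mp hk) y hyS).1
  refine ⟨c, hc, fun b hb => mem_of_inSpan_closed hadd h0 hEchS (hA b hb), ?_⟩
  -- x ∈ span(VB c): y is, and the span is closed under the inverse conjugation
  have hyEch : InSpan (vecs (orbitEch y)) y := by
    have := foldIns_mem (fun k => conj (el k) (eli k) y) (List.range 120) [] (k := 0)
      (List.mem_range.mpr (by norm_num))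
    rw [← horb] at this
    simpa [check_tables.2.2.2.2.2.1, check_tables.2.2.2.2.2.2.1, conj_cI (hS y hyS)] using this
  have hyc : red (VB c) y = 0 :=
    red_eq_zero_of_inSpan (fun v hv => (VB_facts c hc v hv).2.1) (InSpan.mono hB hyEch)
  obtain ⟨hTx, hT0, hT, hT0', hT1'⟩ := VBspan_closed c hc
  have hxc : red (VB c) x = 0 := by
    have := (conj_el_mem hT hT0' hT1' _ hg y hyc).2
    rw [Set.mem_setOf_eq, hy_def, conj_inv_cancel hg (lt_of_red_sB (hxt.symm ▸ h𝔰 x hx)), hxt] at this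
    exact this
  exact inSpan_of_red_eq_zero hxc

/-- `VB 0` is the empty basis (the zero submodule). [folklore] -/
theorem VB_zero : vecs (VB 0) = [] := by decide

/-- THEOREM (the `G`-submodule lattice of `𝔰`, MEANING FORM): every subset `S ⊆ 𝔰 = span(sB)` containing
`0`, closed under `+` and under conjugation by the two generators of `G = ι(S₅(b))` — i.e. every
`𝔽₂[G]`-submodule of `𝔰` — is the span of one of the EIGHT tabulated bases `VB j` (dimensions
`0,1,4,5,5,6,9,10`). [cite: BrumerEtAl2019, Thm 5.3.1 p. 1176] -/
theorem submodules_classified (S : Set ℕ) (h𝔰 : ∀ x ∈ S, red sB x = 0) (h0 : (0 : ℕ) ∈ S)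
    (hadd : ∀ x ∈ S, ∀ y ∈ S, x ^^^ y ∈ S) (hg0 : ∀ x ∈ S, conj cG0 cG0i x ∈ S)
    (hg1 : ∀ x ∈ S, conj cG1 cG1i x ∈ S) : ∃ j < 8, ∀ x, x ∈ S ↔ red (VB j) x = 0 := by
  classical
  let good : ℕ → Prop := fun i => i < 8 ∧ ∀ b ∈ vecs (VB i), b ∈ S
  have hgood0 : good 0 := ⟨by norm_num, by rw [VB_zero]; simp⟩
  have hub : ∀ F : Finset ℕ, (∀ i ∈ F, good i) →
      ∃ j, good j ∧ ∀ i ∈ F, ∀ b ∈ vecs (VB i), InSpan (vecs (VB j)) b := by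
    intro F
    induction F using Finset.induction_on with
    | empty => intro; exact ⟨0, hgood0, by simp⟩
    | @insert i F _ ih =>
      intro hF
      obtain ⟨j, hj, hFj⟩ := ih (fun i' hi' => hF i' (Finset.mem_insert_of_mem hi'))
      have hig : good i := hF i (Finset.mem_insert_self i F)
      obtain ⟨hs8, hsum1, hsum2⟩ := sum_facts i hig.1 j hj.1
      refine ⟨sumIdx i j, ⟨hs8, fun b hb => ?_⟩, fun i' hi' b hb => ?_⟩
      · refine mem_of_inSpan_closed hadd h0 ?_ (hsum2 b hb)
        intro v hv
        rcases List.mem_append.mp hv with hv | hv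
        · exact hig.2 v hv
        · exact hj.2 v hv
      · rcases Finset.mem_insert.mp hi' with rfl | hi'
        · exact hsum1 b (List.mem_append_left _ hb)
        · exact InSpan.mono (fun v hv => hsum1 v (List.mem_append_right _ hv)) (hFj i' hi' b hb)
  obtain ⟨j, hj, hJ⟩ := hub ((Finset.range 8).filter fun i => ∀ b ∈ vecs (VB i), b ∈ S) (by
    intro i hi
    rw [Finset.mem_filter, Finset.mem_range] at hi
    exact ⟨hi.1, hi.2⟩)
  refine ⟨j, hj.1, fun x => ⟨fun hx => ?_, fun hx => ?_⟩⟩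
  · obtain ⟨c, hc8, hcS, hxc⟩ := cyclic_submodule h𝔰 h0 hadd hg0 hg1 hx
    have hcJ : c ∈ (Finset.range 8).filter fun i => ∀ b ∈ vecs (VB i), b ∈ S := by
      rw [Finset.mem_filter, Finset.mem_range]; exact ⟨hc8, hcS⟩
    exact red_eq_zero_of_inSpan (fun v hv => (VB_facts j hj.1 v hv).2.1)
      (InSpan.mono (fun v hv => hJ c hcJ v hv) hxc)
  · exact mem_of_inSpan_closed hadd h0 hj.2 (inSpan_of_red_eq_zero hx)

/-- … and the eight spans are pairwise distinct `G`-submodules of `𝔰` with the inclusions `incl`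
(so "exactly eight"). [folklore] -/
theorem VB_distinct : ((List.range 8).all fun i => (List.range 8).all fun j =>
    i == j || !(allRed (VB i) (vecs (VB j)) && allRed (VB j) (vecs (VB i)))) = true := by
  decide

end Meaning

end Literature.NumberTheory.FaltingsSerre.GSp4F2.Ext
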